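import Literature.Analysis.FunctionSpaces.TimeMollification
import Mathlib.MeasureTheory.Function.ContinuousMapDense
import HarnessLib

/-!
# Limits of doubled (time-mollified) pairings in mixed Lebesgue norms

Analysis/FunctionSpaces theorem file (no definitions). The passage to the limit in Serrin's
doubling-of-the-time-variable argument (Serrin 1963, §4; for local Leray solutions of the
Navier–Stokes equations, Lemarié-Rieusset 2016, proof of Thm. 14.7, p. 515) requires
`∫∫ ρₙ(s-σ) (∫_K ⟪a(s,x), b(σ,x)⟫ dx) dσ ds → ∫ (∫_K ⟪a(s,x), b(s,x)⟫ dx) ds` as the even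
unit-mass kernels `ρₙ` concentrate, for factors `a ∈ L^p_t L^q_x`, `b ∈ L^{p'}_t L^{q'}_x` in
*mixed* Lebesgue norms (the accepted `tendsto_integral_normed_mul_integral_inner` treats
`L²_{t,x} × L²_{t,x}` only). This file proves the general statement by density: the doubled
pairing and the diagonal pairing are both bounded by `‖a‖_{L^p_t L^q_x} ‖b‖_{L^{p'}_t L^{q'}_x}`
(Hölder in `x`, then the weighted Young inequality `lintegral_lintegral_normed_mul_mul_le` in
time, or the unit mass of the kernel when `p = 1`); `a` is approximated in the mixed norm by
continuous compactly supported fields (truncation and Mathlib's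
`MemLp.exists_hasCompactSupport_eLpNorm_sub_le`, the mixed norm of the error being controlled
by dominated convergence in both variables); and for a continuous compactly supported `g` the
difference of the two pairings is at most `ω_g(rOutₙ) ‖b‖_{L¹}` by uniform continuity.

**Main results.**
* `tendsto_lintegral_eLpNorm_rpow_of_dominated` — dominated convergence for mixed norms
  `∫ ‖hₖ(s,·)‖_{L^q}^p ds → 0`.
* `tendsto_doubledPairing_sub_of_continuous` — the continuous compactly supported case.
* `tendsto_doubledPairing_of_bounds` — the abstract density argument.
* `tendsto_doubledPairing_of_essSup`, `tendsto_doubledPairing_of_rpow` — the mixed-norm limit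
  theorems for `p = 1` (with `b ∈ L^∞_t L^{q'}_x`) and for `1 < p < ∞` (`b ∈ L^{p'}_t L^{q'}_x`).

## Mathlib / tree search

Tree: `TimeMollification` (`lintegral_lintegral_normed_mul_mul_le`,
`lintegral_ofReal_normed_sub_left/right`, `aemeasurable_eLpNorm_slice`,
`tendsto_integral_normed_mul_integral_inner` = the `L² × L²` case). Mathlib:
`MemLp.exists_hasCompactSupport_eLpNorm_sub_le`, `tendstoInMeasure_of_tendsto_eLpNorm`,
`TendstoInMeasure.exists_seq_tendsto_ae`, `eLpNorm_le_eLpNorm_mul_eLpNorm_of_nnnorm`,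
`HasCompactSupport.uniformContinuous_of_continuous`. No mixed-norm (`L^p_t L^q_x`) convergence
of mollifications exists in Mathlib or the tree (searched `timeConv`, `normed volume (p.2 - p.1)`,
`eLpNorm (u s)`).

## References

* J. Serrin, *The initial value problem for the Navier–Stokes equations*, in: Nonlinear Problems
  (Madison 1962), Univ. Wisconsin Press 1963, §4. [Serrin1963]
* P. G. Lemarié-Rieusset, *The Navier–Stokes Problem in the 21st Century*, CRC Press 2016,
  doi:10.1201/b19556, proof of Thm. 14.7, p. 515. [LemarieRieusset2016]
-/

noncomputable section

open MeasureTheory TopologicalSpace Set Function Filter Topology Metric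
open scoped ENNReal NNReal Convolution RealInnerProductSpace

namespace Literature.Analysis.FunctionSpaces

/-! ## Dominated convergence for mixed norms -/

section MixedDCT

variable {X : Type*} [MeasurableSpace X] {κ : Measure X} [SFinite κ]
variable {V : Type*} [NormedAddCommGroup V]

/-- **Dominated convergence in a mixed Lebesgue norm.** If jointly (a.e.-)measurable fields
`hₖ : S × X → V` are dominated, `‖hₖ(s,x)‖ ≤ F(s,x)` a.e., by a field `F` with
`∫_S ‖F(s,·)‖_{L^q(κ)}^p ds < ∞` (`0 < p`, `0 < q < ∞`), and `hₖ → 0` a.e. on `S × X`, then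
`∫_S ‖hₖ(s,·)‖_{L^q(κ)}^p ds → 0` (dominated convergence in `x` for a.e. `s`, then in `s`).
[folklore] -/
theorem tendsto_lintegral_eLpNorm_rpow_of_dominated {S : Set ℝ}
    {h : ℕ → ℝ → X → V} {F : ℝ → X → ℝ}
    (hh : ∀ k, AEStronglyMeasurable (uncurry (h k)) ((volume.restrict S).prod κ))
    (hF : AEStronglyMeasurable (uncurry F) ((volume.restrict S).prod κ))
    (hbd : ∀ k, ∀ᵐ z ∂((volume.restrict S).prod κ), ‖uncurry (h k) z‖ ≤ F z.1 z.2)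
    (hlim : ∀ᵐ z ∂((volume.restrict S).prod κ), Tendsto (fun k => uncurry (h k) z) atTop (𝓝 0))
    {p : ℝ} (hp : 0 < p) {q : ℝ≥0∞} (hq : q ≠ 0) (hq' : q ≠ ∞)
    (hFi : ∫⁻ s, eLpNorm (F s) q κ ^ p ∂(volume.restrict S) ≠ ∞) :
    Tendsto (fun k => ∫⁻ s, eLpNorm (h k s) q κ ^ p ∂(volume.restrict S)) atTop (𝓝 0) := by
  set ν : Measure ℝ := volume.restrict S with hν
  have hqr : 0 < q.toReal := ENNReal.toReal_pos hq hq'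
  -- slice statements
  have h1 : ∀ᵐ s ∂ν, ∀ k, ∀ᵐ x ∂κ, ‖h k s x‖ ≤ F s x := by
    rw [ae_all_iff]
    intro k
    exact Measure.ae_ae_of_ae_prod (hbd k)
  have h2 : ∀ᵐ s ∂ν, ∀ᵐ x ∂κ, Tendsto (fun k => h k s x) atTop (𝓝 0) :=
    Measure.ae_ae_of_ae_prod (p := fun z : ℝ × X => Tendsto (fun k => h k z.1 z.2) atTop (𝓝 0)) hlim
  have hsm : ∀ᵐ s ∂ν, ∀ k, AEStronglyMeasurable (h k s) κ := by
    rw [ae_all_iff]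
    intro k
    exact (hh k).prodMk_left
  have hFs : AEMeasurable (fun s => eLpNorm (F s) q κ) ν := aemeasurable_eLpNorm_slice hF q
  have hks : ∀ k, AEMeasurable (fun s => eLpNorm (h k s) q κ) ν := fun k =>
    aemeasurable_eLpNorm_slice (hh k) q
  have hFfin : ∀ᵐ s ∂ν, eLpNorm (F s) q κ < ∞ := by
    filter_upwards [ae_lt_top' (hFs.pow_const p) hFi] with s hs
    exact (ENNReal.rpow_lt_top_iff_of_pos hp).1 hs
  -- inner dominated convergence
  have hinner : ∀ᵐ s ∂ν, Tendsto (fun k => eLpNorm (h k s) q κ) atTop (𝓝 0) := by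
    filter_upwards [h1, h2, hsm, hFfin] with s hb hl hm hFl
    have hlin : Tendsto (fun k => ∫⁻ x, ‖h k s x‖ₑ ^ q.toReal ∂κ) atTop (𝓝 (∫⁻ _ : X, 0 ∂κ)) := by
      refine tendsto_lintegral_of_dominated_convergence' (fun x => ‖F s x‖ₑ ^ q.toReal)
        (fun k => (hm k).enorm.pow_const _) (fun k => ?_) ?_ ?_
      · filter_upwards [hb k] with x hx
        refine ENNReal.rpow_le_rpow ?_ hqr.le
        rw [← ofReal_norm, ← ofReal_norm]
        exact ENNReal.ofReal_le_ofReal (hx.trans (Real.le_norm_self _))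
      · rw [lintegral_rpow_enorm_eq_rpow_eLpNorm' hqr, ← eLpNorm_eq_eLpNorm' hq hq']
        exact (ENNReal.rpow_lt_top_of_nonneg hqr.le hFl.ne).ne
      · filter_upwards [hl] with x hx
        have h0 : Tendsto (fun k => ‖h k s x‖ₑ) atTop (𝓝 0) := by
          have := (continuous_enorm.tendsto (0 : V)).comp hx
          simpa [Function.comp_def] using this
        have := ((ENNReal.continuous_rpow_const (y := q.toReal)).tendsto 0).comp h0
        simpa [Function.comp_def, ENNReal.zero_rpow_of_pos hqr] using this
    rw [lintegral_zero] at hlin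
    have h3 := ((ENNReal.continuous_rpow_const (y := 1 / q.toReal)).tendsto 0).comp hlin
    have h4 : (fun k => eLpNorm (h k s) q κ) =
        (fun y : ℝ≥0∞ => y ^ (1 / q.toReal)) ∘ fun k => ∫⁻ x, ‖h k s x‖ₑ ^ q.toReal ∂κ := by
      funext k
      simp only [Function.comp_apply]
      rw [eLpNorm_eq_lintegral_rpow_enorm_toReal hq hq']
    rw [h4]
    simpa [ENNReal.zero_rpow_of_pos (inv_pos.2 hqr)] using h3
  -- outer dominated convergence
  have hout := tendsto_lintegral_of_dominated_convergence' (μ := ν)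
    (F := fun k s => eLpNorm (h k s) q κ ^ p) (f := fun _ => 0)
    (fun s => eLpNorm (F s) q κ ^ p) (fun k => (hks k).pow_const p) (fun k => ?_) hFi ?_
  · simpa only [lintegral_zero] using hout
  · filter_upwards [h1] with s hb
    refine ENNReal.rpow_le_rpow (eLpNorm_mono_ae ?_) hp.le
    filter_upwards [hb k] with x hx
    exact hx.trans (Real.le_norm_self _)
  · filter_upwards [hinner] with s hs
    have := ((ENNReal.continuous_rpow_const (y := p)).tendsto 0).comp hs
    simpa [Function.comp_def, ENNReal.zero_rpow_of_pos hp] using this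

end MixedDCT

/-! ## The continuous compactly supported case -/

section Continuous

variable {X : Type*} [NormedAddCommGroup X] [NormedSpace ℝ X] [FiniteDimensional ℝ X]
  [MeasurableSpace X] [BorelSpace X] {μ : Measure X} [SFinite μ]
variable {V : Type*} [NormedAddCommGroup V] [InnerProductSpace ℝ V]

/-- Full mass of the translated kernel on `(0,T)` away from the ends: for `δ ≤ σ ≤ T - δ` and
`rOut < δ`, `∫_{(0,T)} ρ(s - σ) ds = 1`. [folklore] -/
theorem setIntegral_Ioo_normed_sub_eq_one (φ : ContDiffBump (0 : ℝ)) {T δ σ : ℝ}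
    (hφ : φ.rOut < δ) (hσ : σ ∈ Icc δ (T - δ)) :
    ∫ s in Ioo 0 T, φ.normed volume (s - σ) = 1 := by
  rw [setIntegral_eq_integral_of_forall_compl_eq_zero, integral_sub_right_eq_self,
    φ.integral_normed]
  intro s hs
  refine normed_eq_zero_of_rOut_le_abs φ ?_
  by_contra hlt
  push Not at hlt
  refine hs ⟨?_, ?_⟩
  · have := (abs_lt.1 (hlt.trans hφ)).1; linarith [hσ.1]
  · have := (abs_lt.1 (hlt.trans hφ)).2; linarith [hσ.2]

/-- The translated kernel has mass at most one on `(0,T)`. [folklore] -/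
theorem setIntegral_Ioo_normed_sub_le_one (φ : ContDiffBump (0 : ℝ)) (T σ : ℝ) :
    ∫ s in Ioo 0 T, φ.normed volume (s - σ) ≤ 1 := by
  calc ∫ s in Ioo 0 T, φ.normed volume (s - σ) ≤ ∫ s, φ.normed volume (s - σ) :=
        setIntegral_le_integral ((φ.integrable_normed).comp_sub_right σ)
          (Eventually.of_forall fun s => φ.nonneg_normed _)
    _ = 1 := by rw [integral_sub_right_eq_self, φ.integral_normed]

/-- If `ρ(s - σ) ≠ 0` then `|s - σ| < rOut`. [folklore] -/
theorem abs_sub_lt_rOut_of_normed_ne_zero (φ : ContDiffBump (0 : ℝ)) {s σ : ℝ}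
    (h : φ.normed volume (s - σ) ≠ 0) : |s - σ| < φ.rOut := by
  by_contra hle
  push Not at hle
  exact h (normed_eq_zero_of_rOut_le_abs φ hle)

omit [NormedAddCommGroup X] [NormedSpace ℝ X] [FiniteDimensional ℝ X] [BorelSpace X] in
/-- Joint measurability of the doubled integrand `((σ,s),x) ↦ ⟪a(s,x), b(σ,x)⟫` on
`((0,T) × (0,T)) × K` for a.e.-jointly measurable `a`, `b` on `(0,T) × K` (composition with the
quasi-measure-preserving coordinate maps). [folklore] -/
theorem aestronglyMeasurable_doubled_inner {T : ℝ} {K : Set X} {a b : ℝ → X → V}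
    (ha : AEStronglyMeasurable (uncurry a) ((volume.restrict (Ioo 0 T)).prod (μ.restrict K)))
    (hb : AEStronglyMeasurable (uncurry b) ((volume.restrict (Ioo 0 T)).prod (μ.restrict K))) :
    AEStronglyMeasurable (fun w : (ℝ × ℝ) × X => ⟪a w.1.2 w.2, b w.1.1 w.2⟫)
      ((((volume : Measure ℝ).restrict (Ioo 0 T)).prod ((volume : Measure ℝ).restrict (Ioo 0 T))).prod
        (μ.restrict K)) := by
  set μI : Measure ℝ := volume.restrict (Ioo 0 T) with hμI
  set μK : Measure X := μ.restrict K with hμK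
  have hq1 : Measure.QuasiMeasurePreserving (fun w : (ℝ × ℝ) × X => (w.1.1, w.2))
      ((μI.prod μI).prod μK) (μI.prod μK) :=
    MeasureTheory.QuasiMeasurePreserving.prodMap Measure.quasiMeasurePreserving_fst
      (Measure.QuasiMeasurePreserving.id μK)
  have hq2 : Measure.QuasiMeasurePreserving (fun w : (ℝ × ℝ) × X => (w.1.2, w.2))
      ((μI.prod μI).prod μK) (μI.prod μK) :=
    MeasureTheory.QuasiMeasurePreserving.prodMap Measure.quasiMeasurePreserving_snd
      (Measure.QuasiMeasurePreserving.id μK)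
  exact (ha.comp_quasiMeasurePreserving hq2).inner (hb.comp_quasiMeasurePreserving hq1)

omit [SFinite μ] in
/-- The diagonal pairing integrand `⟪g(s,x), b(s,x)⟫` of a bounded continuous compactly supported
`g` against `b ∈ L¹((0,T) × K)` is integrable. [folklore] -/
theorem integrable_inner_of_continuous {T : ℝ} {K : Set X}
    {g : ℝ → X → V} (hgc : Continuous (uncurry g)) (hgK : HasCompactSupport (uncurry g))
    {b : ℝ → X → V}
    (hb : AEStronglyMeasurable (uncurry b) ((volume.restrict (Ioo 0 T)).prod (μ.restrict K)))
    (hbi : Integrable (uncurry b) ((volume.restrict (Ioo 0 T)).prod (μ.restrict K))) :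
    Integrable (fun z : ℝ × X => ⟪g z.1 z.2, b z.1 z.2⟫)
      (((volume : Measure ℝ).restrict (Ioo 0 T)).prod (μ.restrict K)) := by
  obtain ⟨Cg, hCg⟩ := hgc.bounded_above_of_compact_support hgK
  refine Integrable.mono' (hbi.norm.const_mul Cg) ((hgc.aestronglyMeasurable).inner hb)
    (Eventually.of_forall fun z => ?_)
  exact (norm_inner_le_norm _ _).trans (mul_le_mul_of_nonneg_right (hCg (z.1, z.2)) (norm_nonneg _))

/-- The doubled pairing integrand `(σ,s) ↦ ρ(s-σ) ∫_K ⟪g(s,x), b(σ,x)⟫ dx` of a bounded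
continuous compactly supported `g` against `b ∈ L¹((0,T) × K)` is integrable on `(0,T)²`.
[folklore] -/
theorem integrable_doubled_of_continuous (φ : ContDiffBump (0 : ℝ)) {T : ℝ} {K : Set X}
    {g : ℝ → X → V} (hgc : Continuous (uncurry g)) (hgK : HasCompactSupport (uncurry g))
    {b : ℝ → X → V}
    (hb : AEStronglyMeasurable (uncurry b) ((volume.restrict (Ioo 0 T)).prod (μ.restrict K)))
    (hbi : Integrable (uncurry b) ((volume.restrict (Ioo 0 T)).prod (μ.restrict K))) :
    Integrable (fun pr : ℝ × ℝ =>
        φ.normed volume (pr.2 - pr.1) * ∫ x, ⟪g pr.2 x, b pr.1 x⟫ ∂(μ.restrict K))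
      (((volume : Measure ℝ).restrict (Ioo 0 T)).prod ((volume : Measure ℝ).restrict (Ioo 0 T))) := by
  set μI : Measure ℝ := volume.restrict (Ioo 0 T) with hμI
  set μK : Measure X := μ.restrict K with hμK
  haveI : IsFiniteMeasure μI := by rw [hμI]; infer_instance
  obtain ⟨Cg, hCg⟩ := hgc.bounded_above_of_compact_support hgK
  have hCg' : ∀ s x, ‖g s x‖ ≤ Cg := fun s x => hCg (s, x)
  obtain ⟨Cρ, hCρ0, hCρ⟩ := exists_normed_le φ
  have hbσ : ∀ᵐ σ ∂μI, Integrable (b σ) μK := hbi.prod_right_ae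
  have hB1 : Integrable (fun σ => ∫ x, ‖b σ x‖ ∂μK) μI := hbi.norm.integral_prod_left
  have hJb : ∀ᵐ σ ∂μI, ∀ s, ‖∫ x, ⟪g s x, b σ x⟫ ∂μK‖ ≤ Cg * ∫ x, ‖b σ x‖ ∂μK := by
    filter_upwards [hbσ] with σ hσ s
    calc ‖∫ x, ⟪g s x, b σ x⟫ ∂μK‖ ≤ ∫ x, ‖⟪g s x, b σ x⟫‖ ∂μK := norm_integral_le_integral_norm _
      _ ≤ ∫ x, Cg * ‖b σ x‖ ∂μK := by
          refine integral_mono_of_nonneg (Eventually.of_forall fun x => norm_nonneg _)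
            (hσ.norm.const_mul Cg) (Eventually.of_forall fun x => ?_)
          exact (norm_inner_le_norm _ _).trans (mul_le_mul_of_nonneg_right (hCg' _ _) (norm_nonneg _))
      _ = Cg * ∫ x, ‖b σ x‖ ∂μK := integral_const_mul _ _
  have hm : AEStronglyMeasurable (fun pr : ℝ × ℝ =>
      φ.normed volume (pr.2 - pr.1) * ∫ x, ⟪g pr.2 x, b pr.1 x⟫ ∂μK) (μI.prod μI) :=
    (φ.continuous_normed.comp (continuous_snd.sub continuous_fst)).aestronglyMeasurable.mul
      (aestronglyMeasurable_doubled_inner hgc.aestronglyMeasurable hb).integral_prod_right'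
  have hdom : Integrable (fun pr : ℝ × ℝ => Cρ * (Cg * ∫ x, ‖b pr.1 x‖ ∂μK)) (μI.prod μI) :=
    ((hB1.const_mul Cg).const_mul Cρ).comp_fst μI
  refine hdom.mono' hm ?_
  have hae : ∀ᵐ pr ∂(μI.prod μI), ∀ s, ‖∫ x, ⟪g s x, b pr.1 x⟫ ∂μK‖ ≤ Cg * ∫ x, ‖b pr.1 x‖ ∂μK :=
    (Measure.quasiMeasurePreserving_fst (μ := μI) (ν := μI)).ae hJb
  filter_upwards [hae] with pr hpr
  rw [norm_mul, Real.norm_eq_abs, abs_of_nonneg (φ.nonneg_normed _)]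
  exact mul_le_mul (hCρ _) (hpr _) (norm_nonneg _) hCρ0

/-- **The doubled pairing of a continuous compactly supported field converges to the diagonal
pairing.** For `g : ℝ × X → V` continuous with compact support, vanishing for
`s ∉ [δ, T - δ]`, a set `K ⊆ X` and `b ∈ L¹((0,T) × K)`,
`∫∫ ρₙ(s-σ) ∫_K ⟪g(s,x), b(σ,x)⟫ dx dσ ds - ∫∫_K ⟪g(s,x), b(s,x)⟫ dx ds → 0` as `rOut ρₙ → 0`:
using `∫_{(0,T)} ρₙ(s-σ) ds = 1` for `σ ∈ [δ, T-δ]` the difference is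
`∫∫ ρₙ(s-σ) ∫_K ⟪g(s,x) - g(σ,x), b(σ,x)⟫`, which is at most `ω_g(rOut ρₙ) ‖b‖_{L¹}` by uniform
continuity of `g` (Serrin 1963, §4, limit step). [cite: Serrin1963, §4] -/
theorem tendsto_doubledPairing_sub_of_continuous
    {φ : ℕ → ContDiffBump (0 : ℝ)} (hφ : Tendsto (fun n => (φ n).rOut) atTop (𝓝 0))
    {T δ : ℝ} (hδ : 0 < δ) {K : Set X}
    {g : ℝ → X → V} (hgc : Continuous (uncurry g)) (hgK : HasCompactSupport (uncurry g))
    (hgS : ∀ s, s ∉ Icc δ (T - δ) → g s = 0)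
    {b : ℝ → X → V}
    (hb : AEStronglyMeasurable (uncurry b) ((volume.restrict (Ioo 0 T)).prod (μ.restrict K)))
    (hbi : Integrable (uncurry b) ((volume.restrict (Ioo 0 T)).prod (μ.restrict K))) :
    Tendsto (fun n =>
      (∫ pr, (φ n).normed volume (pr.2 - pr.1) * ∫ x, ⟪g pr.2 x, b pr.1 x⟫ ∂(μ.restrict K)
          ∂((volume.restrict (Ioo 0 T)).prod (volume.restrict (Ioo 0 T)))) -
        ∫ z, ⟪g z.1 z.2, b z.1 z.2⟫ ∂((volume.restrict (Ioo 0 T)).prod (μ.restrict K)))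
      atTop (𝓝 0) := by
  set μI : Measure ℝ := volume.restrict (Ioo 0 T) with hμI
  set μK : Measure X := μ.restrict K with hμK
  haveI : IsFiniteMeasure μI := by rw [hμI]; infer_instance
  -- bound and uniform continuity of `g`
  obtain ⟨Cg, hCg⟩ := hgc.bounded_above_of_compact_support hgK
  have hCg' : ∀ s x, ‖g s x‖ ≤ Cg := fun s x => hCg (s, x)
  have hCg0 : 0 ≤ Cg := (norm_nonneg _).trans (hCg ((0 : ℝ), (0 : X)))
  have huc : UniformContinuous (uncurry g) := hgK.uniformContinuous_of_continuous hgc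
  -- slices of `b`
  have hbσ : ∀ᵐ σ ∂μI, Integrable (b σ) μK := hbi.prod_right_ae
  have hB1 : Integrable (fun σ => ∫ x, ‖b σ x‖ ∂μK) μI := hbi.norm.integral_prod_left
  set L : ℝ := ∫ σ, ∫ x, ‖b σ x‖ ∂μK ∂μI with hL
  have hL0 : 0 ≤ L := integral_nonneg fun σ => integral_nonneg fun x => norm_nonneg _
  -- integrability of the pairings
  have hDint : Integrable (fun z : ℝ × X => ⟪g z.1 z.2, b z.1 z.2⟫) (μI.prod μK) :=
    integrable_inner_of_continuous hgc hgK hb hbi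
  have hPint : ∀ n, Integrable (fun pr : ℝ × ℝ =>
      (φ n).normed volume (pr.2 - pr.1) * ∫ x, ⟪g pr.2 x, b pr.1 x⟫ ∂μK) (μI.prod μI) := fun n =>
    integrable_doubled_of_continuous (φ n) hgc hgK hb hbi
  -- ### the `ε`-argument
  rw [Metric.tendsto_atTop]
  intro ε hε
  have hε' : 0 < ε / (L + 1) := by positivity
  obtain ⟨η, hη, hηg⟩ := Metric.uniformContinuous_iff.1 huc (ε / (L + 1)) hε'
  obtain ⟨N, hN⟩ := (Metric.tendsto_atTop.1 hφ) (min η δ) (lt_min hη hδ)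
  refine ⟨N, fun n hn => ?_⟩
  have hr : (φ n).rOut < min η δ := by
    have := hN n hn
    rwa [Real.dist_0_eq_abs, abs_of_pos (φ n).rOut_pos] at this
  have hrη : (φ n).rOut < η := hr.trans_le (min_le_left _ _)
  have hrδ : (φ n).rOut < δ := hr.trans_le (min_le_right _ _)
  set ρ : ℝ → ℝ := (φ n).normed volume with hρ
  have hρc : Continuous ρ := (φ n).continuous_normed
  have hρ0 : ∀ x, 0 ≤ ρ x := fun x => (φ n).nonneg_normed x
  -- `D = ∫_σ ∫_s ρ(s-σ) J σ σ`
  have hmass : ∀ σ, ∫ s, ρ (s - σ) * ∫ x, ⟪g σ x, b σ x⟫ ∂μK ∂μI = ∫ x, ⟪g σ x, b σ x⟫ ∂μK := by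
    intro σ
    rw [integral_mul_const]
    by_cases hσ : σ ∈ Icc δ (T - δ)
    · rw [show ∫ s, ρ (s - σ) ∂μI = 1 from setIntegral_Ioo_normed_sub_eq_one (φ n) hrδ hσ, one_mul]
    · simp [hgS σ hσ]
  have hD : ∫ z, ⟪g z.1 z.2, b z.1 z.2⟫ ∂(μI.prod μK) =
      ∫ σ, ∫ s, ρ (s - σ) * ∫ x, ⟪g σ x, b σ x⟫ ∂μK ∂μI ∂μI := by
    rw [integral_prod _ hDint]
    exact integral_congr_ae (Eventually.of_forall fun σ => (hmass σ).symm)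
  have hP : ∫ pr, ρ (pr.2 - pr.1) * ∫ x, ⟪g pr.2 x, b pr.1 x⟫ ∂μK ∂(μI.prod μI) =
      ∫ σ, ∫ s, ρ (s - σ) * ∫ x, ⟪g s x, b σ x⟫ ∂μK ∂μI ∂μI := integral_prod _ (hPint n)
  -- integrability in `σ` of the two inner integrals
  have iP : Integrable (fun σ => ∫ s, ρ (s - σ) * ∫ x, ⟪g s x, b σ x⟫ ∂μK ∂μI) μI :=
    (hPint n).integral_prod_left
  have iD : Integrable (fun σ => ∫ s, ρ (s - σ) * ∫ x, ⟪g σ x, b σ x⟫ ∂μK ∂μI) μI := by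
    have : (fun σ => ∫ s, ρ (s - σ) * ∫ x, ⟪g σ x, b σ x⟫ ∂μK ∂μI) =
        fun σ => ∫ x, ⟪g σ x, b σ x⟫ ∂μK := funext hmass
    rw [this]
    exact hDint.integral_prod_left
  -- the pointwise estimate of the inner difference
  have hinner : ∀ᵐ σ ∂μI,
      ‖(∫ s, ρ (s - σ) * ∫ x, ⟪g s x, b σ x⟫ ∂μK ∂μI) - ∫ s, ρ (s - σ) * ∫ x, ⟪g σ x, b σ x⟫ ∂μK ∂μI‖ ≤
        ε / (L + 1) * ∫ x, ‖b σ x‖ ∂μK := by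
    filter_upwards [hbσ, (hPint n).prod_right_ae] with σ hσ hiσ
    have hgi : ∀ s, Integrable (fun x => ⟪g s x, b σ x⟫) μK := fun s =>
      Integrable.mono' (hσ.norm.const_mul Cg) ((hgc.comp (Continuous.prodMk_right s)).aestronglyMeasurable.inner
        hσ.aestronglyMeasurable) (Eventually.of_forall fun x =>
          (norm_inner_le_norm _ _).trans (mul_le_mul_of_nonneg_right (hCg' _ _) (norm_nonneg _)))
    have iσ2 : Integrable (fun s => ρ (s - σ) * ∫ x, ⟪g σ x, b σ x⟫ ∂μK) μI :=
      ((hρc.comp (continuous_id.sub continuous_const)).mul continuous_const).integrableOn_Icc.mono_set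
        Ioo_subset_Icc_self
    rw [← integral_sub hiσ iσ2]
    have hpt : ∀ s, ‖ρ (s - σ) * ∫ x, ⟪g s x, b σ x⟫ ∂μK - ρ (s - σ) * ∫ x, ⟪g σ x, b σ x⟫ ∂μK‖ ≤
        ρ (s - σ) * (ε / (L + 1) * ∫ x, ‖b σ x‖ ∂μK) := by
      intro s
      rw [← mul_sub, norm_mul, Real.norm_eq_abs, abs_of_nonneg (hρ0 _)]
      by_cases h0 : ρ (s - σ) = 0
      · rw [h0, zero_mul, zero_mul]
      refine mul_le_mul_of_nonneg_left ?_ (hρ0 _)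
      have hsσ : |s - σ| < (φ n).rOut := abs_sub_lt_rOut_of_normed_ne_zero (φ n) h0
      rw [← integral_sub (hgi s) (hgi σ)]
      calc ‖∫ x, ⟪g s x, b σ x⟫ - ⟪g σ x, b σ x⟫ ∂μK‖
          ≤ ∫ x, ‖⟪g s x, b σ x⟫ - ⟪g σ x, b σ x⟫‖ ∂μK := norm_integral_le_integral_norm _
        _ ≤ ∫ x, ε / (L + 1) * ‖b σ x‖ ∂μK := by
            refine integral_mono_of_nonneg (Eventually.of_forall fun x => norm_nonneg _)
              (hσ.norm.const_mul _) (Eventually.of_forall fun x => ?_)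
            simp only
            rw [← inner_sub_left]
            refine (norm_inner_le_norm _ _).trans (mul_le_mul_of_nonneg_right ?_ (norm_nonneg _))
            have hd : dist (g s x) (g σ x) < ε / (L + 1) := by
              have := @hηg (s, x) (σ, x) (by
                rw [Prod.dist_eq, dist_self, max_eq_left dist_nonneg, Real.dist_eq]
                exact hsσ.trans hrη)
              simpa [uncurry] using this
            rw [dist_eq_norm] at hd
            exact hd.le
        _ = ε / (L + 1) * ∫ x, ‖b σ x‖ ∂μK := integral_const_mul _ _
    calc ‖∫ s, ρ (s - σ) * ∫ x, ⟪g s x, b σ x⟫ ∂μK - ρ (s - σ) * ∫ x, ⟪g σ x, b σ x⟫ ∂μK ∂μI‖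
        ≤ ∫ s, ‖ρ (s - σ) * ∫ x, ⟪g s x, b σ x⟫ ∂μK - ρ (s - σ) * ∫ x, ⟪g σ x, b σ x⟫ ∂μK‖ ∂μI :=
          norm_integral_le_integral_norm _
      _ ≤ ∫ s, ρ (s - σ) * (ε / (L + 1) * ∫ x, ‖b σ x‖ ∂μK) ∂μI := by
          refine integral_mono_of_nonneg (Eventually.of_forall fun s => norm_nonneg _) ?_
            (Eventually.of_forall hpt)
          exact ((hρc.comp (continuous_id.sub continuous_const)).mul continuous_const).integrableOn_Icc.mono_set
            Ioo_subset_Icc_self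
      _ = (∫ s, ρ (s - σ) ∂μI) * (ε / (L + 1) * ∫ x, ‖b σ x‖ ∂μK) := integral_mul_const _ _
      _ ≤ 1 * (ε / (L + 1) * ∫ x, ‖b σ x‖ ∂μK) := by
          refine mul_le_mul_of_nonneg_right (setIntegral_Ioo_normed_sub_le_one (φ n) T σ) ?_
          exact mul_nonneg hε'.le (integral_nonneg fun x => norm_nonneg _)
      _ = ε / (L + 1) * ∫ x, ‖b σ x‖ ∂μK := one_mul _
  -- conclusion
  rw [Real.dist_0_eq_abs, hP, hD, ← integral_sub iP iD]
  calc |∫ σ, (∫ s, ρ (s - σ) * ∫ x, ⟪g s x, b σ x⟫ ∂μK ∂μI) -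
          ∫ s, ρ (s - σ) * ∫ x, ⟪g σ x, b σ x⟫ ∂μK ∂μI ∂μI|
      ≤ ∫ σ, ‖(∫ s, ρ (s - σ) * ∫ x, ⟪g s x, b σ x⟫ ∂μK ∂μI) -
          ∫ s, ρ (s - σ) * ∫ x, ⟪g σ x, b σ x⟫ ∂μK ∂μI‖ ∂μI := by
        rw [← Real.norm_eq_abs]; exact norm_integral_le_integral_norm _
    _ ≤ ∫ σ, ε / (L + 1) * ∫ x, ‖b σ x‖ ∂μK ∂μI :=
        integral_mono_of_nonneg (Eventually.of_forall fun σ => norm_nonneg _) (hB1.const_mul _) hinner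
    _ = ε / (L + 1) * L := by rw [integral_const_mul]
    _ < ε := by
        rw [div_mul_eq_mul_div, div_lt_iff₀ (by linarith)]
        nlinarith

end Continuous

/-! ## Radial truncation and time cut-offs -/

section Truncation

variable {V : Type*} [NormedAddCommGroup V] [NormedSpace ℝ V]

/-- The radial truncation `v ↦ (M / max M ‖v‖) v` is continuous (`M > 0`). [folklore] -/
theorem continuous_radialTrunc {M : ℝ} (hM : 0 < M) :
    Continuous fun v : V => (M / max M ‖v‖) • v := by
  refine Continuous.smul (continuous_const.div (continuous_const.max continuous_norm) fun v => ?_)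
    continuous_id
  exact (lt_of_lt_of_le hM (le_max_left _ _)).ne'

/-- The radial truncation is the identity on the ball of radius `M`. [folklore] -/
theorem radialTrunc_eq_self {M : ℝ} (hM : 0 < M) {v : V} (hv : ‖v‖ ≤ M) :
    (M / max M ‖v‖) • v = v := by
  rw [max_eq_left hv, div_self hM.ne', one_smul]

/-- The radial truncation has norm at most `M` and at most `‖v‖`. [folklore] -/
theorem norm_radialTrunc_le {M : ℝ} (hM : 0 < M) (v : V) :
    ‖(M / max M ‖v‖) • v‖ ≤ M ∧ ‖(M / max M ‖v‖) • v‖ ≤ ‖v‖ := by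
  have hmax : 0 < max M ‖v‖ := lt_of_lt_of_le hM (le_max_left _ _)
  rw [norm_smul, Real.norm_eq_abs, abs_of_nonneg (div_nonneg hM.le hmax.le)]
  constructor
  · rw [div_mul_eq_mul_div, div_le_iff₀ hmax]
    exact mul_le_mul_of_nonneg_left (le_max_right _ _) hM.le
  · refine mul_le_of_le_one_left (norm_nonneg _) ?_
    rw [div_le_one hmax]
    exact le_max_left _ _

/-- The truncation error is at most `‖v‖`. [folklore] -/
theorem norm_sub_radialTrunc_le {M : ℝ} (hM : 0 < M) (v : V) :
    ‖v - (M / max M ‖v‖) • v‖ ≤ ‖v‖ := by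
  have hmax : 0 < max M ‖v‖ := lt_of_lt_of_le hM (le_max_left _ _)
  have h1 : v - (M / max M ‖v‖) • v = (1 - M / max M ‖v‖) • v := by
    rw [sub_smul, one_smul]
  have hc0 : 0 ≤ 1 - M / max M ‖v‖ := by
    rw [sub_nonneg, div_le_one hmax]; exact le_max_left _ _
  have hc1 : 1 - M / max M ‖v‖ ≤ 1 := by
    rw [sub_le_self_iff]; exact div_nonneg hM.le hmax.le
  rw [h1, norm_smul, Real.norm_eq_abs, abs_of_nonneg hc0]
  exact mul_le_of_le_one_left (norm_nonneg _) hc1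

/-- A continuous piecewise linear cut-off in time: `θ = 1` on `[δ, T-δ]`, `θ = 0` outside
`(δ/2, T-δ/2)`, `0 ≤ θ ≤ 1`. [folklore] -/
theorem exists_continuous_cutoff {δ : ℝ} (hδ : 0 < δ) (T : ℝ) :
    ∃ θ : ℝ → ℝ, Continuous θ ∧ (∀ s, 0 ≤ θ s) ∧ (∀ s, θ s ≤ 1) ∧
      (∀ s ∈ Icc δ (T - δ), θ s = 1) ∧ (∀ s, s ∉ Ioo (δ / 2) (T - δ / 2) → θ s = 0) := by
  refine ⟨fun s => min 1 (max 0 (2 / δ * (s - δ / 2))) * min 1 (max 0 (2 / δ * (T - δ / 2 - s))),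
    ?_, fun s => ?_, fun s => ?_, fun s hs => ?_, fun s hs => ?_⟩
  · fun_prop
  · exact mul_nonneg (le_min zero_le_one (le_max_left _ _)) (le_min zero_le_one (le_max_left _ _))
  · exact mul_le_one₀ (min_le_left _ _) (le_min zero_le_one (le_max_left _ _)) (min_le_left _ _)
  · have hδ1 : 2 / δ * (δ / 2) = 1 := by field_simp
    have h1 : 1 ≤ 2 / δ * (s - δ / 2) := by
      rw [← hδ1]; exact mul_le_mul_of_nonneg_left (by linarith [hs.1]) (by positivity)
    have h2 : 1 ≤ 2 / δ * (T - δ / 2 - s) := by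
      rw [← hδ1]; exact mul_le_mul_of_nonneg_left (by linarith [hs.2]) (by positivity)
    simp only
    rw [min_eq_left (h1.trans (le_max_right _ _)), min_eq_left (h2.trans (le_max_right _ _)), mul_one]
  · simp only [mem_Ioo, not_and_or, not_lt] at hs
    simp only
    rcases hs with hs | hs
    · have : 2 / δ * (s - δ / 2) ≤ 0 := mul_nonpos_iff.2 (Or.inl ⟨by positivity, by linarith⟩)
      rw [max_eq_left this, min_eq_right zero_le_one, zero_mul]
    · have : 2 / δ * (T - δ / 2 - s) ≤ 0 := mul_nonpos_iff.2 (Or.inl ⟨by positivity, by linarith⟩)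
      rw [max_eq_left this, min_eq_right zero_le_one, mul_zero]

end Truncation

/-! ## Hölder bounds for the doubled and the diagonal pairings -/

section Bounds

variable {X : Type*} [MeasurableSpace X] {μ : Measure X} [SFinite μ]
variable {V : Type*} [NormedAddCommGroup V] [InnerProductSpace ℝ V]

/-- Hölder in `x` for the doubled variables: for a.e. `(σ, s) ∈ (0,T)²`,
`∫_K |⟪h(s,x), b(σ,x)⟫| dx ≤ ‖h(s,·)‖_{L^q(K)} ‖b(σ,·)‖_{L^{q'}(K)}`. [folklore] -/
theorem ae_lintegral_enorm_inner_le {T : ℝ} {K : Set X} {h b : ℝ → X → V}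
    (hh : AEStronglyMeasurable (uncurry h) ((volume.restrict (Ioo 0 T)).prod (μ.restrict K)))
    (hb : AEStronglyMeasurable (uncurry b) ((volume.restrict (Ioo 0 T)).prod (μ.restrict K)))
    (q q' : ℝ≥0∞) [hqq' : q.HolderConjugate q'] :
    ∀ᵐ pr ∂(((volume : Measure ℝ).restrict (Ioo 0 T)).prod ((volume : Measure ℝ).restrict (Ioo 0 T))),
      ∫⁻ x, ‖⟪h pr.2 x, b pr.1 x⟫‖ₑ ∂(μ.restrict K) ≤
        eLpNorm (h pr.2) q (μ.restrict K) * eLpNorm (b pr.1) q' (μ.restrict K) := by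
  set μI : Measure ℝ := volume.restrict (Ioo 0 T) with hμI
  set μK : Measure X := μ.restrict K with hμK
  have h2 : ∀ᵐ pr ∂(μI.prod μI), AEStronglyMeasurable (h pr.2) μK :=
    (Measure.quasiMeasurePreserving_snd (μ := μI) (ν := μI)).ae hh.prodMk_left
  have h1 : ∀ᵐ pr ∂(μI.prod μI), AEStronglyMeasurable (b pr.1) μK :=
    (Measure.quasiMeasurePreserving_fst (μ := μI) (ν := μI)).ae hb.prodMk_left
  filter_upwards [h1, h2] with pr hb' hh'
  have := eLpNorm_le_eLpNorm_mul_eLpNorm'_of_norm (p := q) (q := q') (r := 1) hh' hb'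
    (fun u v => ⟪u, v⟫) 1 (Eventually.of_forall fun x => by
      rw [NNReal.coe_one, one_mul]; exact norm_inner_le_norm _ _)
  rwa [eLpNorm_one_eq_lintegral_enorm, ENNReal.coe_one, one_mul] at this

/-- Hölder in `x` on the diagonal: for a.e. `s ∈ (0,T)`,
`∫_K |⟪h(s,x), b(s,x)⟫| dx ≤ ‖h(s,·)‖_{L^q(K)} ‖b(s,·)‖_{L^{q'}(K)}`. [folklore] -/
theorem ae_lintegral_enorm_inner_le_diag {T : ℝ} {K : Set X} {h b : ℝ → X → V}
    (hh : AEStronglyMeasurable (uncurry h) ((volume.restrict (Ioo 0 T)).prod (μ.restrict K)))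
    (hb : AEStronglyMeasurable (uncurry b) ((volume.restrict (Ioo 0 T)).prod (μ.restrict K)))
    (q q' : ℝ≥0∞) [hqq' : q.HolderConjugate q'] :
    ∀ᵐ s ∂((volume : Measure ℝ).restrict (Ioo 0 T)),
      ∫⁻ x, ‖⟪h s x, b s x⟫‖ₑ ∂(μ.restrict K) ≤
        eLpNorm (h s) q (μ.restrict K) * eLpNorm (b s) q' (μ.restrict K) := by
  filter_upwards [hh.prodMk_left, hb.prodMk_left] with s hh' hb'
  have := eLpNorm_le_eLpNorm_mul_eLpNorm'_of_norm (p := q) (q := q') (r := 1) hh' hb'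
    (fun u v => ⟪u, v⟫) 1 (Eventually.of_forall fun x => by
      rw [NNReal.coe_one, one_mul]; exact norm_inner_le_norm _ _)
  rwa [eLpNorm_one_eq_lintegral_enorm, ENNReal.coe_one, one_mul] at this

/-- **Bound for the doubled pairing of a sum, up to the time step**:
`∫∫ ρ(s-σ) ∫_K |⟪h₁+h₂, b⟫| ≤ ∫∫ ρ(s-σ) (‖h₁(s)‖_q + ‖h₂(s)‖_q) ‖b(σ)‖_{q'}`. [folklore] -/
theorem lintegral_doubled_le (φ : ContDiffBump (0 : ℝ)) {T : ℝ} {K : Set X} {h₁ h₂ b : ℝ → X → V}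
    (hh₁ : AEStronglyMeasurable (uncurry h₁) ((volume.restrict (Ioo 0 T)).prod (μ.restrict K)))
    (hh₂ : AEStronglyMeasurable (uncurry h₂) ((volume.restrict (Ioo 0 T)).prod (μ.restrict K)))
    (hb : AEStronglyMeasurable (uncurry b) ((volume.restrict (Ioo 0 T)).prod (μ.restrict K)))
    (q q' : ℝ≥0∞) [hqq' : q.HolderConjugate q'] :
    ∫⁻ pr, ENNReal.ofReal (φ.normed volume (pr.2 - pr.1)) *
        ∫⁻ x, ‖⟪h₁ pr.2 x + h₂ pr.2 x, b pr.1 x⟫‖ₑ ∂(μ.restrict K)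
        ∂(((volume : Measure ℝ).restrict (Ioo 0 T)).prod ((volume : Measure ℝ).restrict (Ioo 0 T))) ≤
      ∫⁻ σ, ∫⁻ s, ENNReal.ofReal (φ.normed volume (s - σ)) *
        ((eLpNorm (h₁ s) q (μ.restrict K) + eLpNorm (h₂ s) q (μ.restrict K)) *
          eLpNorm (b σ) q' (μ.restrict K)) ∂((volume : Measure ℝ).restrict (Ioo 0 T))
        ∂((volume : Measure ℝ).restrict (Ioo 0 T)) := by
  set μI : Measure ℝ := volume.restrict (Ioo 0 T) with hμI
  set μK : Measure X := μ.restrict K with hμK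
  have hae₁ := ae_lintegral_enorm_inner_le (μ := μ) hh₁ hb q q'
  have hae₂ := ae_lintegral_enorm_inner_le (μ := μ) hh₂ hb q q'
  have hm₁ : ∀ᵐ pr ∂(μI.prod μI), AEStronglyMeasurable (h₁ pr.2) μK :=
    (Measure.quasiMeasurePreserving_snd (μ := μI) (ν := μI)).ae hh₁.prodMk_left
  have hmb : ∀ᵐ pr ∂(μI.prod μI), AEStronglyMeasurable (b pr.1) μK :=
    (Measure.quasiMeasurePreserving_fst (μ := μI) (ν := μI)).ae hb.prodMk_left
  calc ∫⁻ pr, ENNReal.ofReal (φ.normed volume (pr.2 - pr.1)) *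
        ∫⁻ x, ‖⟪h₁ pr.2 x + h₂ pr.2 x, b pr.1 x⟫‖ₑ ∂μK ∂(μI.prod μI)
      ≤ ∫⁻ pr, ENNReal.ofReal (φ.normed volume (pr.2 - pr.1)) *
          ((eLpNorm (h₁ pr.2) q μK + eLpNorm (h₂ pr.2) q μK) * eLpNorm (b pr.1) q' μK) ∂(μI.prod μI) := by
        refine lintegral_mono_ae ?_
        filter_upwards [hae₁, hae₂, hm₁, hmb] with pr h1 h2 hm hm'
        refine mul_le_mul' le_rfl ?_
        calc ∫⁻ x, ‖⟪h₁ pr.2 x + h₂ pr.2 x, b pr.1 x⟫‖ₑ ∂μK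
            ≤ ∫⁻ x, ‖⟪h₁ pr.2 x, b pr.1 x⟫‖ₑ + ‖⟪h₂ pr.2 x, b pr.1 x⟫‖ₑ ∂μK := by
              refine lintegral_mono fun x => ?_
              rw [inner_add_left]
              exact enorm_add_le _ _
          _ = (∫⁻ x, ‖⟪h₁ pr.2 x, b pr.1 x⟫‖ₑ ∂μK) + ∫⁻ x, ‖⟪h₂ pr.2 x, b pr.1 x⟫‖ₑ ∂μK :=
              lintegral_add_left' (hm.inner hm').enorm _
          _ ≤ _ := by rw [add_mul]; exact add_le_add h1 h2
    _ ≤ _ := lintegral_prod_le _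

/-- **Bound for the diagonal pairing of a sum, up to the time step**:
`∫∫_K |⟪h₁+h₂, b⟫| ≤ ∫ (‖h₁(s)‖_q + ‖h₂(s)‖_q) ‖b(s)‖_{q'} ds`. [folklore] -/
theorem lintegral_diag_le {T : ℝ} {K : Set X} {h₁ h₂ b : ℝ → X → V}
    (hh₁ : AEStronglyMeasurable (uncurry h₁) ((volume.restrict (Ioo 0 T)).prod (μ.restrict K)))
    (hh₂ : AEStronglyMeasurable (uncurry h₂) ((volume.restrict (Ioo 0 T)).prod (μ.restrict K)))
    (hb : AEStronglyMeasurable (uncurry b) ((volume.restrict (Ioo 0 T)).prod (μ.restrict K)))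
    (q q' : ℝ≥0∞) [hqq' : q.HolderConjugate q'] :
    ∫⁻ z, ‖⟪h₁ z.1 z.2 + h₂ z.1 z.2, b z.1 z.2⟫‖ₑ ∂(((volume : Measure ℝ).restrict (Ioo 0 T)).prod (μ.restrict K)) ≤
      ∫⁻ s, (eLpNorm (h₁ s) q (μ.restrict K) + eLpNorm (h₂ s) q (μ.restrict K)) *
        eLpNorm (b s) q' (μ.restrict K) ∂((volume : Measure ℝ).restrict (Ioo 0 T)) := by
  set μI : Measure ℝ := volume.restrict (Ioo 0 T) with hμI
  set μK : Measure X := μ.restrict K with hμK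
  have hae₁ := ae_lintegral_enorm_inner_le_diag (μ := μ) hh₁ hb q q'
  have hae₂ := ae_lintegral_enorm_inner_le_diag (μ := μ) hh₂ hb q q'
  calc ∫⁻ z, ‖⟪h₁ z.1 z.2 + h₂ z.1 z.2, b z.1 z.2⟫‖ₑ ∂(μI.prod μK)
      ≤ ∫⁻ s, ∫⁻ x, ‖⟪h₁ s x + h₂ s x, b s x⟫‖ₑ ∂μK ∂μI := lintegral_prod_le _
    _ ≤ _ := by
        refine lintegral_mono_ae ?_
        filter_upwards [hae₁, hae₂, hh₁.prodMk_left, hb.prodMk_left] with s h1 h2 hm hm'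
        calc ∫⁻ x, ‖⟪h₁ s x + h₂ s x, b s x⟫‖ₑ ∂μK
            ≤ ∫⁻ x, ‖⟪h₁ s x, b s x⟫‖ₑ + ‖⟪h₂ s x, b s x⟫‖ₑ ∂μK := by
              refine lintegral_mono fun x => ?_
              rw [inner_add_left]
              exact enorm_add_le _ _
          _ = (∫⁻ x, ‖⟪h₁ s x, b s x⟫‖ₑ ∂μK) + ∫⁻ x, ‖⟪h₂ s x, b s x⟫‖ₑ ∂μK :=
              lintegral_add_left' (hm.inner hm').enorm _
          _ ≤ _ := by rw [add_mul]; exact add_le_add h1 h2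

/-- **The time step for `p = 1`**: with an a.e. bound `B ≤ C_b`, the unit mass of the kernel gives
`∫∫ ρ(s-σ) H(s) B(σ) ≤ C_b ∫ H`. [folklore] -/
theorem lintegral_lintegral_normed_le_of_ae_le (φ : ContDiffBump (0 : ℝ)) {T : ℝ}
    {H B : ℝ → ℝ≥0∞} (hH : AEMeasurable H ((volume : Measure ℝ).restrict (Ioo 0 T)))
    {Cb : ℝ≥0∞} (hB : ∀ᵐ σ ∂((volume : Measure ℝ).restrict (Ioo 0 T)), B σ ≤ Cb) :
    ∫⁻ σ, ∫⁻ s, ENNReal.ofReal (φ.normed volume (s - σ)) * (H s * B σ)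
        ∂((volume : Measure ℝ).restrict (Ioo 0 T)) ∂((volume : Measure ℝ).restrict (Ioo 0 T)) ≤
      Cb * ∫⁻ s, H s ∂((volume : Measure ℝ).restrict (Ioo 0 T)) := by
  set μI : Measure ℝ := volume.restrict (Ioo 0 T) with hμI
  have hρm : Measurable fun z : ℝ × ℝ => ENNReal.ofReal (φ.normed volume (z.2 - z.1)) :=
    ENNReal.measurable_ofReal.comp (φ.continuous_normed.measurable.comp (measurable_snd.sub measurable_fst))
  calc ∫⁻ σ, ∫⁻ s, ENNReal.ofReal (φ.normed volume (s - σ)) * (H s * B σ) ∂μI ∂μI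
      ≤ ∫⁻ σ, ∫⁻ s, ENNReal.ofReal (φ.normed volume (s - σ)) * H s * Cb ∂μI ∂μI := by
        refine lintegral_mono_ae (hB.mono fun σ hσ => lintegral_mono fun s => ?_)
        rw [mul_assoc]
        exact mul_le_mul' le_rfl (mul_le_mul' le_rfl hσ)
    _ = (∫⁻ σ, ∫⁻ s, ENNReal.ofReal (φ.normed volume (s - σ)) * H s ∂μI ∂μI) * Cb := by
        have hF : AEMeasurable (uncurry fun σ s => ENNReal.ofReal (φ.normed volume (s - σ)) * H s)
            (μI.prod μI) := hρm.aemeasurable.mul hH.comp_snd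
        have hO : AEMeasurable (fun σ => ∫⁻ s, ENNReal.ofReal (φ.normed volume (s - σ)) * H s ∂μI) μI :=
          hF.lintegral_prod_right'
        rw [← lintegral_mul_const'' _ hO]
        refine lintegral_congr fun σ => ?_
        have hmσ : AEMeasurable (fun s => ENNReal.ofReal (φ.normed volume (s - σ)) * H s) μI :=
          (ENNReal.measurable_ofReal.comp
            (φ.continuous_normed.measurable.comp (measurable_id.sub measurable_const))).aemeasurable.mul hH
        rw [lintegral_mul_const'' _ hmσ]
    _ = (∫⁻ s, ∫⁻ σ, ENNReal.ofReal (φ.normed volume (s - σ)) * H s ∂μI ∂μI) * Cb := by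
        have hF : AEMeasurable (uncurry fun σ s => ENNReal.ofReal (φ.normed volume (s - σ)) * H s)
            (μI.prod μI) := hρm.aemeasurable.mul hH.comp_snd
        rw [lintegral_lintegral_swap hF]
    _ ≤ (∫⁻ s, H s ∂μI) * Cb := by
        refine mul_le_mul' (lintegral_mono fun s => ?_) le_rfl
        have hms : Measurable fun σ => ENNReal.ofReal (φ.normed volume (s - σ)) :=
          ENNReal.measurable_ofReal.comp
            (φ.continuous_normed.measurable.comp (measurable_const.sub measurable_id))
        rw [lintegral_mul_const _ hms]
        calc (∫⁻ σ, ENNReal.ofReal (φ.normed volume (s - σ)) ∂μI) * H s ≤ 1 * H s := by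
              refine mul_le_mul' ?_ le_rfl
              exact (lintegral_mono' Measure.restrict_le_self le_rfl).trans
                (lintegral_ofReal_normed_sub_left φ s).le
          _ = H s := one_mul _
    _ = Cb * ∫⁻ s, H s ∂μI := mul_comm _ _

end Bounds

/-! ## The density argument -/

section Core

variable {X : Type*} [NormedAddCommGroup X] [NormedSpace ℝ X] [FiniteDimensional ℝ X]
  [MeasurableSpace X] [BorelSpace X] {μ : Measure X} [SFinite μ] [IsFiniteMeasureOnCompacts μ]
variable {V : Type*} [NormedAddCommGroup V] [InnerProductSpace ℝ V]

/-- **Doubled pairings converge to the diagonal pairing (abstract density argument).** Let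
`a : (0,T) × K → V` vanish for `s ∉ [δ, T-δ]` and have finite mixed norm
`N(a) = (∫ ‖a(s,·)‖_{L^q(K)}^p ds)^{1/p}` (`0 < p`, `0 < q < ∞`), let `b ∈ L¹((0,T) × K)`, and
suppose the doubled pairings `Pₙ(h) = ∫∫ ρₙ(s-σ) ∫_K ⟪h(s,x), b(σ,x)⟫` and the diagonal pairing
`D(h) = ∫∫_K ⟪h(s,x), b(s,x)⟫` are bounded by `C_b (N(h₁) + N(h₂))` on sums `h = h₁ + h₂`
(`C_b < ∞`). Then `Pₙ(a) → D(a)`. Proof: truncate `a` in height and approximate the truncation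
a.e. (hence, by dominated convergence, in the mixed norm) by continuous compactly supported
fields (`MemLp.exists_hasCompactSupport_eLpNorm_sub_le`, a subsequence converging a.e.,
re-truncated and cut off in time); for those `Pₙ - D → 0`
(`tendsto_doubledPairing_sub_of_continuous`), and the errors are controlled by the bounds.
[cite: Serrin1963, §4] -/
theorem tendsto_doubledPairing_of_bounds
    {φ : ℕ → ContDiffBump (0 : ℝ)} (hφ : Tendsto (fun n => (φ n).rOut) atTop (𝓝 0))
    {T δ : ℝ} (hδ : 0 < δ) {K : Set X} (hK : IsCompact K)
    {a b : ℝ → X → V}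
    (ha : AEStronglyMeasurable (uncurry a) ((volume.restrict (Ioo 0 T)).prod (μ.restrict K)))
    (haS : ∀ s, s ∉ Icc δ (T - δ) → a s = 0)
    (hb : AEStronglyMeasurable (uncurry b) ((volume.restrict (Ioo 0 T)).prod (μ.restrict K)))
    (hbi : Integrable (uncurry b) ((volume.restrict (Ioo 0 T)).prod (μ.restrict K)))
    {p : ℝ} (hp : 0 < p) {q : ℝ≥0∞} (hq : q ≠ 0) (hq' : q ≠ ∞)
    (haN : ∫⁻ s, eLpNorm (a s) q (μ.restrict K) ^ p ∂(volume.restrict (Ioo 0 T)) ≠ ∞)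
    {Cb : ℝ≥0∞} (hCb : Cb ≠ ∞)
    (hPbd : ∀ (n : ℕ) (h₁ h₂ : ℝ → X → V),
      AEStronglyMeasurable (uncurry h₁) ((volume.restrict (Ioo 0 T)).prod (μ.restrict K)) →
      AEStronglyMeasurable (uncurry h₂) ((volume.restrict (Ioo 0 T)).prod (μ.restrict K)) →
      ‖∫ pr, (φ n).normed volume (pr.2 - pr.1) * ∫ x, ⟪h₁ pr.2 x + h₂ pr.2 x, b pr.1 x⟫ ∂(μ.restrict K)
          ∂((volume.restrict (Ioo 0 T)).prod (volume.restrict (Ioo 0 T)))‖ₑ ≤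
        Cb * ((∫⁻ s, eLpNorm (h₁ s) q (μ.restrict K) ^ p ∂(volume.restrict (Ioo 0 T))) ^ (1 / p) +
          (∫⁻ s, eLpNorm (h₂ s) q (μ.restrict K) ^ p ∂(volume.restrict (Ioo 0 T))) ^ (1 / p)))
    (hDbd : ∀ (h₁ h₂ : ℝ → X → V),
      AEStronglyMeasurable (uncurry h₁) ((volume.restrict (Ioo 0 T)).prod (μ.restrict K)) →
      AEStronglyMeasurable (uncurry h₂) ((volume.restrict (Ioo 0 T)).prod (μ.restrict K)) →
      ‖∫ z, ⟪h₁ z.1 z.2 + h₂ z.1 z.2, b z.1 z.2⟫ ∂((volume.restrict (Ioo 0 T)).prod (μ.restrict K))‖ₑ ≤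
        Cb * ((∫⁻ s, eLpNorm (h₁ s) q (μ.restrict K) ^ p ∂(volume.restrict (Ioo 0 T))) ^ (1 / p) +
          (∫⁻ s, eLpNorm (h₂ s) q (μ.restrict K) ^ p ∂(volume.restrict (Ioo 0 T))) ^ (1 / p)))
    (hPint : ∀ n, Integrable (fun pr : ℝ × ℝ =>
      (φ n).normed volume (pr.2 - pr.1) * ∫ x, ⟪a pr.2 x, b pr.1 x⟫ ∂(μ.restrict K))
      ((volume.restrict (Ioo 0 T)).prod (volume.restrict (Ioo 0 T))))
    (haI : ∀ᵐ pr ∂((volume.restrict (Ioo 0 T)).prod (volume.restrict (Ioo 0 T))),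
      Integrable (fun x => ⟪a pr.2 x, b pr.1 x⟫) (μ.restrict K))
    (hDint : Integrable (fun z : ℝ × X => ⟪a z.1 z.2, b z.1 z.2⟫)
      ((volume.restrict (Ioo 0 T)).prod (μ.restrict K))) :
    Tendsto (fun n => ∫ pr, (φ n).normed volume (pr.2 - pr.1) * ∫ x, ⟪a pr.2 x, b pr.1 x⟫ ∂(μ.restrict K)
        ∂((volume.restrict (Ioo 0 T)).prod (volume.restrict (Ioo 0 T)))) atTop
      (𝓝 (∫ z, ⟪a z.1 z.2, b z.1 z.2⟫ ∂((volume.restrict (Ioo 0 T)).prod (μ.restrict K)))) := by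
  set μI : Measure ℝ := volume.restrict (Ioo 0 T) with hμI
  set μK : Measure X := μ.restrict K with hμK
  haveI : IsFiniteMeasure μI := by rw [hμI]; infer_instance
  haveI : IsFiniteMeasure μK := by
    rw [hμK]; exact isFiniteMeasure_restrict.2 hK.measure_lt_top.ne
  have hp1 : 0 < 1 / p := one_div_pos.2 hp
  -- from `∫⁻ N^p → 0` to `Cb * N → 0`
  have hsmall : ∀ {N : ℕ → ℝ≥0∞}, Tendsto N atTop (𝓝 0) →
      Tendsto (fun k => Cb * N k ^ (1 / p)) atTop (𝓝 0) := by
    intro N hN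
    have h1 := ((ENNReal.continuous_rpow_const (y := 1 / p)).tendsto 0).comp hN
    have h2 := ENNReal.Tendsto.const_mul (a := Cb) h1 (Or.inr hCb)
    rw [ENNReal.zero_rpow_of_pos hp1, mul_zero] at h2
    exact h2
  -- slices of `b`
  have hbσ : ∀ᵐ σ ∂μI, Integrable (b σ) μK := hbi.prod_right_ae
  have hbpr : ∀ᵐ pr ∂(μI.prod μI), Integrable (b pr.1) μK :=
    (Measure.quasiMeasurePreserving_fst (μ := μI) (ν := μI)).ae hbσ
  -- ### Step 1: truncation in height
  set aM : ℕ → ℝ → X → V := fun k s x => (((k : ℝ) + 1) / max ((k : ℝ) + 1) ‖a s x‖) • a s x with haM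
  have hk0 : ∀ k : ℕ, (0 : ℝ) < k + 1 := fun k => Nat.cast_add_one_pos k
  have haMm : ∀ k, AEStronglyMeasurable (uncurry (aM k)) (μI.prod μK) := fun k =>
    (continuous_radialTrunc (hk0 k)).comp_aestronglyMeasurable ha
  have haMS : ∀ k s, s ∉ Icc δ (T - δ) → aM k s = 0 := fun k s hs => by
    funext x; simp [haM, haS s hs]
  have haMb : ∀ k s x, ‖aM k s x‖ ≤ (k : ℝ) + 1 := fun k s x => (norm_radialTrunc_le (hk0 k) _).1
  have hN1 : Tendsto (fun k => ∫⁻ s, eLpNorm (fun x => a s x - aM k s x) q μK ^ p ∂μI) atTop (𝓝 0) := by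
    refine tendsto_lintegral_eLpNorm_rpow_of_dominated (S := Ioo 0 T) (κ := μK)
      (h := fun k s x => a s x - aM k s x) (F := fun s x => ‖a s x‖)
      (fun k => ha.sub (haMm k)) ha.norm (fun k => Eventually.of_forall fun z => ?_)
      (Eventually.of_forall fun z => ?_) hp hq hq' ?_
    · exact norm_sub_radialTrunc_le (hk0 k) _
    · have hev : ∀ᶠ k : ℕ in atTop, uncurry (fun s x => a s x - aM k s x) z = 0 := by
        obtain ⟨k₀, hk₀⟩ := exists_nat_ge ‖a z.1 z.2‖
        refine eventually_atTop.2 ⟨k₀, fun k hk => ?_⟩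
        have hle : ‖a z.1 z.2‖ ≤ (k : ℝ) + 1 := by
          have : (k₀ : ℝ) ≤ k := Nat.cast_le.2 hk
          linarith
        simp only [uncurry, haM, radialTrunc_eq_self (hk0 k) hle, sub_self]
      exact tendsto_const_nhds.congr' (hev.mono fun k hk => hk.symm)
    · simp_rw [eLpNorm_norm]
      exact haN
  -- ### the `ε`-argument
  rw [Metric.tendsto_atTop]
  intro ε hε
  have hε8 : (0 : ℝ≥0∞) < ENNReal.ofReal (ε / 8) := ENNReal.ofReal_pos.2 (by positivity)
  obtain ⟨k₀, hk₀⟩ := ENNReal.tendsto_atTop_zero.1 (hsmall hN1) _ hε8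
  have hT1 : Cb * (∫⁻ s, eLpNorm (fun x => a s x - aM k₀ s x) q μK ^ p ∂μI) ^ (1 / p) ≤
      ENNReal.ofReal (ε / 8) := hk₀ k₀ le_rfl
  set M : ℝ := (k₀ : ℝ) + 1 with hMdef
  have hM : 0 < M := hk0 k₀
  -- ### Step 2: continuous compactly supported approximants of the truncation
  have haMmem : MemLp (uncurry (aM k₀)) 1 (μI.prod μK) :=
    MemLp.of_bound (haMm k₀) M (Eventually.of_forall fun z => haMb k₀ z.1 z.2)
  have hex : ∀ j : ℕ, ∃ g : ℝ × X → V, HasCompactSupport g ∧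
      eLpNorm (uncurry (aM k₀) - g) 1 (μI.prod μK) ≤ ((j : ℝ≥0∞) + 1)⁻¹ ∧ Continuous g ∧
      MemLp g 1 (μI.prod μK) := fun j =>
    haMmem.exists_hasCompactSupport_eLpNorm_sub_le ENNReal.one_ne_top (by simp)
  choose g hgK hgε hgc _ using hex
  have hgm : ∀ j, AEStronglyMeasurable (g j) (μI.prod μK) := fun j => (hgc j).aestronglyMeasurable
  have htim : TendstoInMeasure (μI.prod μK) g atTop (uncurry (aM k₀)) := by
    refine tendstoInMeasure_of_tendsto_eLpNorm one_ne_zero hgm (haMm k₀) ?_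
    refine tendsto_of_tendsto_of_tendsto_of_le_of_le' tendsto_const_nhds
      (h := fun j : ℕ => ((j : ℝ≥0∞) + 1)⁻¹) ?_ (Eventually.of_forall fun _ => zero_le)
      (Eventually.of_forall fun j => ?_)
    · have := ENNReal.tendsto_inv_nat_nhds_zero.comp (tendsto_add_atTop_nat 1)
      simpa [Function.comp_def, Nat.cast_add, Nat.cast_one] using this
    · rw [eLpNorm_sub_comm]; exact hgε j
  obtain ⟨ns, -, hae⟩ := htim.exists_seq_tendsto_ae
  obtain ⟨θ, hθc, hθ0, hθ1, hθS, hθz⟩ := exists_continuous_cutoff hδ T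
  set G : ℕ → ℝ → X → V := fun i s x =>
    θ s • ((M / max M ‖g (ns i) (s, x)‖) • g (ns i) (s, x)) with hG
  have hGc : ∀ i, Continuous (uncurry (G i)) := fun i =>
    (hθc.comp continuous_fst).smul
      ((continuous_radialTrunc hM).comp ((hgc (ns i)).comp (continuous_fst.prodMk continuous_snd)))
  have hGK : ∀ i, HasCompactSupport (uncurry (G i)) := fun i => by
    refine (hgK (ns i)).mono fun z hz => ?_
    rw [mem_support] at hz ⊢
    contrapose! hz
    simp [uncurry, hG, hz]
  have hGS : ∀ i s, s ∉ Icc (δ / 2) (T - δ / 2) → G i s = 0 := fun i s hs => by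
    funext x
    have : θ s = 0 := hθz s fun h => hs (Ioo_subset_Icc_self h)
    simp [hG, this]
  have hGb : ∀ i s x, ‖G i s x‖ ≤ M := fun i s x => by
    simp only [hG]
    rw [norm_smul, Real.norm_eq_abs, abs_of_nonneg (hθ0 s)]
    exact (mul_le_mul (hθ1 s) (norm_radialTrunc_le hM _).1 (norm_nonneg _) zero_le_one).trans
      (by rw [one_mul])
  have hθaM : ∀ s x, θ s • aM k₀ s x = aM k₀ s x := fun s x => by
    by_cases hs : s ∈ Icc δ (T - δ)
    · rw [hθS s hs, one_smul]
    · rw [haMS k₀ s hs]; simp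
  have hGm : ∀ i, AEStronglyMeasurable (uncurry (G i)) (μI.prod μK) := fun i =>
    (hGc i).aestronglyMeasurable
  have hN2 : Tendsto (fun i => ∫⁻ s, eLpNorm (fun x => aM k₀ s x - G i s x) q μK ^ p ∂μI) atTop (𝓝 0) := by
    refine tendsto_lintegral_eLpNorm_rpow_of_dominated (S := Ioo 0 T) (κ := μK)
      (h := fun i s x => aM k₀ s x - G i s x) (F := fun _ _ => M + M)
      (fun i => (haMm k₀).sub (hGm i)) aestronglyMeasurable_const
      (fun i => Eventually.of_forall fun z => ?_) ?_ hp hq hq' ?_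
    · exact (norm_sub_le _ _).trans (add_le_add (haMb k₀ _ _) (hGb i _ _))
    · filter_upwards [hae] with z hz
      have h1 : Tendsto (fun i => (M / max M ‖g (ns i) z‖) • g (ns i) z) atTop
          (𝓝 ((M / max M ‖aM k₀ z.1 z.2‖) • aM k₀ z.1 z.2)) :=
        ((continuous_radialTrunc hM).tendsto _).comp hz
      rw [radialTrunc_eq_self hM (haMb k₀ z.1 z.2)] at h1
      have h2 : Tendsto (fun i => θ z.1 • ((M / max M ‖g (ns i) z‖) • g (ns i) z)) atTop
          (𝓝 (θ z.1 • aM k₀ z.1 z.2)) := h1.const_smul (θ z.1)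
      rw [hθaM z.1 z.2] at h2
      have h3 := (tendsto_const_nhds (x := aM k₀ z.1 z.2)).sub h2
      rw [sub_self] at h3
      simpa [uncurry, hG] using h3
    · -- the constant bound has finite mixed norm
      have hb1 : eLpNorm (fun _ : X => M + M) q μK ≤ μK univ ^ q.toReal⁻¹ * ENNReal.ofReal (M + M) :=
        eLpNorm_le_of_ae_bound (Eventually.of_forall fun x => by
          rw [Real.norm_eq_abs, abs_of_nonneg (by positivity)])
      refine ne_top_of_le_ne_top ?_ (lintegral_mono fun (_ : ℝ) => ENNReal.rpow_le_rpow hb1 hp.le)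
      rw [lintegral_const]
      refine ENNReal.mul_ne_top (ENNReal.rpow_ne_top_of_nonneg hp.le (ENNReal.mul_ne_top ?_ ENNReal.ofReal_ne_top))
        (measure_ne_top _ _)
      exact ENNReal.rpow_ne_top_of_nonneg (inv_nonneg.2 ENNReal.toReal_nonneg) (measure_ne_top _ _)
  obtain ⟨i₀, hi₀⟩ := ENNReal.tendsto_atTop_zero.1 (hsmall hN2) _ hε8
  have hT2 : Cb * (∫⁻ s, eLpNorm (fun x => aM k₀ s x - G i₀ s x) q μK ^ p ∂μI) ^ (1 / p) ≤
      ENNReal.ofReal (ε / 8) := hi₀ i₀ le_rfl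
  -- ### Step 3: the continuous compactly supported field `G i₀`
  have h3 := tendsto_doubledPairing_sub_of_continuous (μ := μ) (K := K) hφ (half_pos hδ) (hGc i₀) (hGK i₀)
    (hGS i₀) hb hbi
  obtain ⟨N₁, hN₁⟩ := (Metric.tendsto_atTop.1 h3) (ε / 4) (by positivity)
  refine ⟨N₁, fun n hn => ?_⟩
  have hPG := integrable_doubled_of_continuous (μ := μ) (φ n) (hGc i₀) (hGK i₀) hb hbi
  have hDG := integrable_inner_of_continuous (μ := μ) (T := T) (hGc i₀) (hGK i₀) hb hbi
  obtain ⟨CG, hCG⟩ := (hGc i₀).bounded_above_of_compact_support (hGK i₀)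
  have hGI : ∀ᵐ pr ∂(μI.prod μI), Integrable (fun x => ⟪G i₀ pr.2 x, b pr.1 x⟫) μK := by
    filter_upwards [hbpr] with pr hpr
    exact Integrable.mono' (hpr.norm.const_mul CG)
      (((hGc i₀).comp (Continuous.prodMk_right pr.2)).aestronglyMeasurable.inner hpr.aestronglyMeasurable)
      (Eventually.of_forall fun x =>
        (norm_inner_le_norm _ _).trans (mul_le_mul_of_nonneg_right (hCG (pr.2, x)) (norm_nonneg _)))
  set ρ : ℝ → ℝ := (φ n).normed volume with hρ
  -- (i) the doubled pairings of `a` and `G i₀`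
  have hPdiff : (∫ pr, ρ (pr.2 - pr.1) * ∫ x, ⟪a pr.2 x, b pr.1 x⟫ ∂μK ∂(μI.prod μI)) -
      ∫ pr, ρ (pr.2 - pr.1) * ∫ x, ⟪G i₀ pr.2 x, b pr.1 x⟫ ∂μK ∂(μI.prod μI) =
      ∫ pr, ρ (pr.2 - pr.1) * ∫ x, ⟪(a pr.2 x - aM k₀ pr.2 x) + (aM k₀ pr.2 x - G i₀ pr.2 x), b pr.1 x⟫ ∂μK
        ∂(μI.prod μI) := by
    rw [← integral_sub (hPint n) hPG]
    refine integral_congr_ae ?_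
    filter_upwards [haI, hGI] with pr h1 h2
    rw [← mul_sub, ← integral_sub h1 h2]
    congr 1
    refine integral_congr_ae (Eventually.of_forall fun x => ?_)
    simp only
    rw [← inner_sub_left, sub_add_sub_cancel]
  have hPB : ‖(∫ pr, ρ (pr.2 - pr.1) * ∫ x, ⟪a pr.2 x, b pr.1 x⟫ ∂μK ∂(μI.prod μI)) -
      ∫ pr, ρ (pr.2 - pr.1) * ∫ x, ⟪G i₀ pr.2 x, b pr.1 x⟫ ∂μK ∂(μI.prod μI)‖ ≤ ε / 4 := by
    have h := hPbd n (fun s x => a s x - aM k₀ s x) (fun s x => aM k₀ s x - G i₀ s x)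
      (ha.sub (haMm k₀)) ((haMm k₀).sub (hGm i₀))
    rw [← hPdiff, mul_add] at h
    have h' := h.trans (add_le_add hT1 hT2)
    rw [← ENNReal.ofReal_add (by positivity) (by positivity), ← ofReal_norm,
      ENNReal.ofReal_le_ofReal_iff (by positivity)] at h'
    linarith
  -- (ii) the diagonal pairings of `a` and `G i₀`
  have hDdiff : (∫ z, ⟪a z.1 z.2, b z.1 z.2⟫ ∂(μI.prod μK)) - ∫ z, ⟪G i₀ z.1 z.2, b z.1 z.2⟫ ∂(μI.prod μK) =
      ∫ z, ⟪(a z.1 z.2 - aM k₀ z.1 z.2) + (aM k₀ z.1 z.2 - G i₀ z.1 z.2), b z.1 z.2⟫ ∂(μI.prod μK) := by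
    rw [← integral_sub hDint hDG]
    refine integral_congr_ae (Eventually.of_forall fun z => ?_)
    simp only
    rw [← inner_sub_left, sub_add_sub_cancel]
  have hDB : ‖(∫ z, ⟪a z.1 z.2, b z.1 z.2⟫ ∂(μI.prod μK)) - ∫ z, ⟪G i₀ z.1 z.2, b z.1 z.2⟫ ∂(μI.prod μK)‖ ≤
      ε / 4 := by
    have h := hDbd (fun s x => a s x - aM k₀ s x) (fun s x => aM k₀ s x - G i₀ s x)
      (ha.sub (haMm k₀)) ((haMm k₀).sub (hGm i₀))
    rw [← hDdiff, mul_add] at h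
    have h' := h.trans (add_le_add hT1 hT2)
    rw [← ENNReal.ofReal_add (by positivity) (by positivity), ← ofReal_norm,
      ENNReal.ofReal_le_ofReal_iff (by positivity)] at h'
    linarith
  -- (iii) the continuous field
  have hGB := hN₁ n hn
  rw [Real.dist_0_eq_abs] at hGB
  -- conclusion
  rw [Real.dist_eq]
  have key : ∀ (Pa PG Da DG : ℝ), Pa - Da = (Pa - PG) - (Da - DG) + (PG - DG) := fun _ _ _ _ => by ring
  rw [key _ (∫ pr, ρ (pr.2 - pr.1) * ∫ x, ⟪G i₀ pr.2 x, b pr.1 x⟫ ∂μK ∂(μI.prod μI)) _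
    (∫ z, ⟪G i₀ z.1 z.2, b z.1 z.2⟫ ∂(μI.prod μK))]
  refine (abs_add_le _ _).trans_lt ?_
  refine lt_of_le_of_lt (add_le_add (abs_sub _ _) le_rfl) ?_
  rw [← Real.norm_eq_abs, ← Real.norm_eq_abs] 
  linarith

end Core

/-! ## The mixed-norm limit theorems -/

section MixedNorm

variable {X : Type*} [NormedAddCommGroup X] [NormedSpace ℝ X] [FiniteDimensional ℝ X]
  [MeasurableSpace X] [BorelSpace X] {μ : Measure X} [SFinite μ] [IsFiniteMeasureOnCompacts μ]
variable {V : Type*} [NormedAddCommGroup V] [InnerProductSpace ℝ V]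

/-- **Doubled pairings converge to the diagonal pairing, `L¹_t L^q_x` against `L^∞_t L^{q'}_x`.**
Let `a : (0,T) × K → V` vanish for `s ∉ [δ, T-δ]` with `∫ ‖a(s,·)‖_{L^q(K)} ds < ∞`
(`1 ≤ q < ∞`), and let `b ∈ L¹((0,T) × K)` with `‖b(σ,·)‖_{L^{q'}(K)} ≤ C_b < ∞` for a.e. `σ`,
`1/q + 1/q' = 1`. Then, as `rOut ρₙ → 0`,
`∫∫ ρₙ(s-σ) ∫_K ⟪a(s,x), b(σ,x)⟫ dx dσ ds → ∫ ∫_K ⟪a(s,x), b(s,x)⟫ dx ds`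
(Serrin 1963, §4, limit step, in mixed norms). [cite: Serrin1963, §4] -/
theorem tendsto_doubledPairing_of_ae_le
    {φ : ℕ → ContDiffBump (0 : ℝ)} (hφ : Tendsto (fun n => (φ n).rOut) atTop (𝓝 0))
    {T δ : ℝ} (hδ : 0 < δ) {K : Set X} (hK : IsCompact K)
    {a b : ℝ → X → V}
    (ha : AEStronglyMeasurable (uncurry a) ((volume.restrict (Ioo 0 T)).prod (μ.restrict K)))
    (haS : ∀ s, s ∉ Icc δ (T - δ) → a s = 0)
    (hb : AEStronglyMeasurable (uncurry b) ((volume.restrict (Ioo 0 T)).prod (μ.restrict K)))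
    (hbi : Integrable (uncurry b) ((volume.restrict (Ioo 0 T)).prod (μ.restrict K)))
    {q q' : ℝ≥0∞} [hqq' : q.HolderConjugate q'] (hq' : q ≠ ∞)
    (haN : ∫⁻ s, eLpNorm (a s) q (μ.restrict K) ∂(volume.restrict (Ioo 0 T)) ≠ ∞)
    {Cb : ℝ≥0∞} (hCb : Cb ≠ ∞)
    (hbB : ∀ᵐ σ ∂((volume : Measure ℝ).restrict (Ioo 0 T)), eLpNorm (b σ) q' (μ.restrict K) ≤ Cb) :
    Tendsto (fun n => ∫ pr, (φ n).normed volume (pr.2 - pr.1) * ∫ x, ⟪a pr.2 x, b pr.1 x⟫ ∂(μ.restrict K)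
        ∂((volume.restrict (Ioo 0 T)).prod (volume.restrict (Ioo 0 T)))) atTop
      (𝓝 (∫ z, ⟪a z.1 z.2, b z.1 z.2⟫ ∂((volume.restrict (Ioo 0 T)).prod (μ.restrict K)))) := by
  set μI : Measure ℝ := volume.restrict (Ioo 0 T) with hμI
  set μK : Measure X := μ.restrict K with hμK
  have hq0 : q ≠ 0 := ENNReal.HolderConjugate.ne_zero q q'
  have hHm : ∀ {h : ℝ → X → V}, AEStronglyMeasurable (uncurry h) (μI.prod μK) →
      AEMeasurable (fun s => eLpNorm (h s) q μK) μI := fun hh => aemeasurable_eLpNorm_slice hh q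
  -- the two bounds in lintegral form
  have hPl : ∀ (n : ℕ) (h₁ h₂ : ℝ → X → V), AEStronglyMeasurable (uncurry h₁) (μI.prod μK) →
      AEStronglyMeasurable (uncurry h₂) (μI.prod μK) →
      ∫⁻ pr, ENNReal.ofReal ((φ n).normed volume (pr.2 - pr.1)) *
          ∫⁻ x, ‖⟪h₁ pr.2 x + h₂ pr.2 x, b pr.1 x⟫‖ₑ ∂μK ∂(μI.prod μI) ≤
        Cb * ((∫⁻ s, eLpNorm (h₁ s) q μK ∂μI) + ∫⁻ s, eLpNorm (h₂ s) q μK ∂μI) := by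
    intro n h₁ h₂ hh₁ hh₂
    refine (lintegral_doubled_le (μ := μ) (φ n) hh₁ hh₂ hb q q').trans ?_
    refine (lintegral_lintegral_normed_le_of_ae_le (φ n)
      (H := fun s => eLpNorm (h₁ s) q μK + eLpNorm (h₂ s) q μK) ((hHm hh₁).add (hHm hh₂)) hbB).trans ?_
    rw [lintegral_add_left' (hHm hh₁)]
  have hDl : ∀ (h₁ h₂ : ℝ → X → V), AEStronglyMeasurable (uncurry h₁) (μI.prod μK) →
      AEStronglyMeasurable (uncurry h₂) (μI.prod μK) →
      ∫⁻ z, ‖⟪h₁ z.1 z.2 + h₂ z.1 z.2, b z.1 z.2⟫‖ₑ ∂(μI.prod μK) ≤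
        Cb * ((∫⁻ s, eLpNorm (h₁ s) q μK ∂μI) + ∫⁻ s, eLpNorm (h₂ s) q μK ∂μI) := by
    intro h₁ h₂ hh₁ hh₂
    refine (lintegral_diag_le (μ := μ) hh₁ hh₂ hb q q').trans ?_
    calc ∫⁻ s, (eLpNorm (h₁ s) q μK + eLpNorm (h₂ s) q μK) * eLpNorm (b s) q' μK ∂μI
        ≤ ∫⁻ s, (eLpNorm (h₁ s) q μK + eLpNorm (h₂ s) q μK) * Cb ∂μI :=
          lintegral_mono_ae (hbB.mono fun s hs => mul_le_mul' le_rfl hs)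
      _ = (∫⁻ s, eLpNorm (h₁ s) q μK + eLpNorm (h₂ s) q μK ∂μI) * Cb :=
          lintegral_mul_const'' _ ((hHm hh₁).add (hHm hh₂))
      _ = _ := by rw [mul_comm, lintegral_add_left' (hHm hh₁)]
  -- the single-field instances
  have hzero : AEStronglyMeasurable (uncurry (0 : ℝ → X → V)) (μI.prod μK) := aestronglyMeasurable_const
  have hPa : ∀ n, ∫⁻ pr, ENNReal.ofReal ((φ n).normed volume (pr.2 - pr.1)) *
      ∫⁻ x, ‖⟪a pr.2 x, b pr.1 x⟫‖ₑ ∂μK ∂(μI.prod μI) ≤ Cb * ∫⁻ s, eLpNorm (a s) q μK ∂μI := by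
    intro n
    have h := hPl n a 0 ha hzero
    simpa only [Pi.zero_apply, add_zero, eLpNorm_zero, lintegral_zero] using h
  have hDa : ∫⁻ z, ‖⟪a z.1 z.2, b z.1 z.2⟫‖ₑ ∂(μI.prod μK) ≤ Cb * ∫⁻ s, eLpNorm (a s) q μK ∂μI := by
    have h := hDl a 0 ha hzero
    simpa only [Pi.zero_apply, add_zero, eLpNorm_zero, lintegral_zero] using h
  have hρJ : ∀ n (h : ℝ → X → V) (pr : ℝ × ℝ),
      ‖(φ n).normed volume (pr.2 - pr.1) * ∫ x, ⟪h pr.2 x, b pr.1 x⟫ ∂μK‖ₑ ≤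
        ENNReal.ofReal ((φ n).normed volume (pr.2 - pr.1)) * ∫⁻ x, ‖⟪h pr.2 x, b pr.1 x⟫‖ₑ ∂μK := by
    intro n h pr
    rw [enorm_mul, Real.enorm_eq_ofReal ((φ n).nonneg_normed _)]
    exact mul_le_mul' le_rfl (enorm_integral_le_lintegral_enorm _)
  refine tendsto_doubledPairing_of_bounds (μ := μ) (p := 1) hφ hδ hK ha haS hb hbi one_pos hq0 hq' ?_ hCb
    ?_ ?_ ?_ ?_ ?_
  · simpa only [ENNReal.rpow_one] using haN
  · intro n h₁ h₂ hh₁ hh₂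
    simp only [ENNReal.rpow_one, div_one]
    exact (enorm_integral_le_lintegral_enorm _).trans
      ((lintegral_mono fun pr => hρJ n (fun s x => h₁ s x + h₂ s x) pr).trans (hPl n h₁ h₂ hh₁ hh₂))
  · intro h₁ h₂ hh₁ hh₂
    simp only [ENNReal.rpow_one, div_one]
    exact (enorm_integral_le_lintegral_enorm _).trans (hDl h₁ h₂ hh₁ hh₂)
  · intro n
    refine ⟨((φ n).continuous_normed.comp (continuous_snd.sub continuous_fst)).aestronglyMeasurable.mul
      (aestronglyMeasurable_doubled_inner ha hb).integral_prod_right', ?_⟩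
    rw [hasFiniteIntegral_iff_enorm]
    exact ((lintegral_mono fun pr => hρJ n a pr).trans (hPa n)).trans_lt
      (ENNReal.mul_lt_top hCb.lt_top haN.lt_top)
  · have hfa : ∀ᵐ s ∂μI, eLpNorm (a s) q μK < ∞ := ae_lt_top' (hHm ha) haN
    filter_upwards [ae_lintegral_enorm_inner_le (μ := μ) ha hb q q',
      (Measure.quasiMeasurePreserving_snd (μ := μI) (ν := μI)).ae hfa,
      (Measure.quasiMeasurePreserving_fst (μ := μI) (ν := μI)).ae hbB,
      (Measure.quasiMeasurePreserving_snd (μ := μI) (ν := μI)).ae ha.prodMk_left,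
      (Measure.quasiMeasurePreserving_fst (μ := μI) (ν := μI)).ae hb.prodMk_left] with pr hH hfa' hfb hma hmb
    refine ⟨hma.inner hmb, ?_⟩
    rw [hasFiniteIntegral_iff_enorm]
    exact hH.trans_lt (ENNReal.mul_lt_top hfa' (hfb.trans_lt hCb.lt_top))
  · refine ⟨ha.inner hb, ?_⟩
    rw [hasFiniteIntegral_iff_enorm]
    exact hDa.trans_lt (ENNReal.mul_lt_top hCb.lt_top haN.lt_top)

/-- **Doubled pairings converge to the diagonal pairing, `L^p_t L^q_x` against
`L^{p'}_t L^{q'}_x`** (`1 < p < ∞`, `1 ≤ q < ∞`, conjugate exponents). Let `a : (0,T) × K → V`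
vanish for `s ∉ [δ, T-δ]` with `∫ ‖a(s,·)‖_{L^q(K)}^p ds < ∞`, and let `b ∈ L¹((0,T) × K)` with
`∫ ‖b(σ,·)‖_{L^{q'}(K)}^{p'} dσ < ∞`. Then, as `rOut ρₙ → 0`,
`∫∫ ρₙ(s-σ) ∫_K ⟪a(s,x), b(σ,x)⟫ dx dσ ds → ∫ ∫_K ⟪a(s,x), b(s,x)⟫ dx ds` (the weighted Young
inequality `lintegral_lintegral_normed_mul_mul_le` in time; Serrin 1963, §4, limit step).
[cite: Serrin1963, §4] -/
theorem tendsto_doubledPairing_of_rpow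
    {φ : ℕ → ContDiffBump (0 : ℝ)} (hφ : Tendsto (fun n => (φ n).rOut) atTop (𝓝 0))
    {T δ : ℝ} (hδ : 0 < δ) {K : Set X} (hK : IsCompact K)
    {a b : ℝ → X → V}
    (ha : AEStronglyMeasurable (uncurry a) ((volume.restrict (Ioo 0 T)).prod (μ.restrict K)))
    (haS : ∀ s, s ∉ Icc δ (T - δ) → a s = 0)
    (hb : AEStronglyMeasurable (uncurry b) ((volume.restrict (Ioo 0 T)).prod (μ.restrict K)))
    (hbi : Integrable (uncurry b) ((volume.restrict (Ioo 0 T)).prod (μ.restrict K)))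
    {p p' : ℝ} (hpp' : p.HolderConjugate p') {q q' : ℝ≥0∞} [hqq' : q.HolderConjugate q'] (hq' : q ≠ ∞)
    (haN : ∫⁻ s, eLpNorm (a s) q (μ.restrict K) ^ p ∂(volume.restrict (Ioo 0 T)) ≠ ∞)
    (hbN : ∫⁻ σ, eLpNorm (b σ) q' (μ.restrict K) ^ p' ∂(volume.restrict (Ioo 0 T)) ≠ ∞) :
    Tendsto (fun n => ∫ pr, (φ n).normed volume (pr.2 - pr.1) * ∫ x, ⟪a pr.2 x, b pr.1 x⟫ ∂(μ.restrict K)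
        ∂((volume.restrict (Ioo 0 T)).prod (volume.restrict (Ioo 0 T)))) atTop
      (𝓝 (∫ z, ⟪a z.1 z.2, b z.1 z.2⟫ ∂((volume.restrict (Ioo 0 T)).prod (μ.restrict K)))) := by
  set μI : Measure ℝ := volume.restrict (Ioo 0 T) with hμI
  set μK : Measure X := μ.restrict K with hμK
  have hq0 : q ≠ 0 := ENNReal.HolderConjugate.ne_zero q q'
  have hp : 0 < p := hpp'.pos
  have hp1 : 1 ≤ p := hpp'.lt.le
  have hHm : ∀ {h : ℝ → X → V}, AEStronglyMeasurable (uncurry h) (μI.prod μK) →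
      AEMeasurable (fun s => eLpNorm (h s) q μK) μI := fun hh => aemeasurable_eLpNorm_slice hh q
  have hBm : AEMeasurable (fun σ => eLpNorm (b σ) q' μK) μI := aemeasurable_eLpNorm_slice hb q'
  set Cb : ℝ≥0∞ := (∫⁻ σ, eLpNorm (b σ) q' μK ^ p' ∂μI) ^ (1 / p') with hCbdef
  have hCb : Cb ≠ ∞ := ENNReal.rpow_ne_top_of_nonneg hpp'.symm.one_div_nonneg hbN
  -- Minkowski in time
  have hMink : ∀ {h₁ h₂ : ℝ → X → V}, AEStronglyMeasurable (uncurry h₁) (μI.prod μK) →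
      AEStronglyMeasurable (uncurry h₂) (μI.prod μK) →
      (∫⁻ s, (eLpNorm (h₁ s) q μK + eLpNorm (h₂ s) q μK) ^ p ∂μI) ^ (1 / p) ≤
        (∫⁻ s, eLpNorm (h₁ s) q μK ^ p ∂μI) ^ (1 / p) + (∫⁻ s, eLpNorm (h₂ s) q μK ^ p ∂μI) ^ (1 / p) :=
    fun hh₁ hh₂ => ENNReal.lintegral_Lp_add_le (hHm hh₁) (hHm hh₂) hp1
  -- the two bounds in lintegral form
  have hPl : ∀ (n : ℕ) (h₁ h₂ : ℝ → X → V), AEStronglyMeasurable (uncurry h₁) (μI.prod μK) →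
      AEStronglyMeasurable (uncurry h₂) (μI.prod μK) →
      ∫⁻ pr, ENNReal.ofReal ((φ n).normed volume (pr.2 - pr.1)) *
          ∫⁻ x, ‖⟪h₁ pr.2 x + h₂ pr.2 x, b pr.1 x⟫‖ₑ ∂μK ∂(μI.prod μI) ≤
        Cb * ((∫⁻ s, eLpNorm (h₁ s) q μK ^ p ∂μI) ^ (1 / p) +
          (∫⁻ s, eLpNorm (h₂ s) q μK ^ p ∂μI) ^ (1 / p)) := by
    intro n h₁ h₂ hh₁ hh₂
    have hcomm : ∀ σ s, (eLpNorm (h₁ s) q μK + eLpNorm (h₂ s) q μK) * eLpNorm (b σ) q' μK =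
        eLpNorm (b σ) q' μK * (eLpNorm (h₁ s) q μK + eLpNorm (h₂ s) q μK) := fun σ s => mul_comm _ _
    calc _ ≤ _ := lintegral_doubled_le (μ := μ) (φ n) hh₁ hh₂ hb q q'
      _ = ∫⁻ σ, ∫⁻ s, ENNReal.ofReal ((φ n).normed volume (s - σ)) *
            (eLpNorm (b σ) q' μK * (eLpNorm (h₁ s) q μK + eLpNorm (h₂ s) q μK)) ∂μI ∂μI :=
          lintegral_congr fun σ => lintegral_congr fun s => by rw [hcomm]
      _ ≤ (∫⁻ σ, eLpNorm (b σ) q' μK ^ p' ∂μI) ^ (1 / p') *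
            (∫⁻ s, (eLpNorm (h₁ s) q μK + eLpNorm (h₂ s) q μK) ^ p ∂μI) ^ (1 / p) :=
          lintegral_lintegral_normed_mul_mul_le (φ n) Measure.restrict_le_self Measure.restrict_le_self
            hBm ((hHm hh₁).add (hHm hh₂)) hpp'.symm
      _ ≤ _ := mul_le_mul' le_rfl (hMink hh₁ hh₂)
  have hDl : ∀ (h₁ h₂ : ℝ → X → V), AEStronglyMeasurable (uncurry h₁) (μI.prod μK) →
      AEStronglyMeasurable (uncurry h₂) (μI.prod μK) →
      ∫⁻ z, ‖⟪h₁ z.1 z.2 + h₂ z.1 z.2, b z.1 z.2⟫‖ₑ ∂(μI.prod μK) ≤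
        Cb * ((∫⁻ s, eLpNorm (h₁ s) q μK ^ p ∂μI) ^ (1 / p) +
          (∫⁻ s, eLpNorm (h₂ s) q μK ^ p ∂μI) ^ (1 / p)) := by
    intro h₁ h₂ hh₁ hh₂
    refine (lintegral_diag_le (μ := μ) hh₁ hh₂ hb q q').trans ?_
    have h := ENNReal.lintegral_mul_le_Lp_mul_Lq μI hpp' ((hHm hh₁).add (hHm hh₂)) hBm
    refine (le_of_eq_of_le (by rfl) h).trans ?_
    rw [mul_comm]
    exact mul_le_mul' le_rfl (hMink hh₁ hh₂)
  -- the single-field instances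
  have hzero : AEStronglyMeasurable (uncurry (0 : ℝ → X → V)) (μI.prod μK) := aestronglyMeasurable_const
  have hN0 : (∫⁻ s, eLpNorm ((0 : ℝ → X → V) s) q μK ^ p ∂μI) ^ (1 / p) = 0 := by
    simp [ENNReal.zero_rpow_of_pos hp, hp]
  have hNa : (∫⁻ s, eLpNorm (a s) q μK ^ p ∂μI) ^ (1 / p) ≠ ∞ :=
    ENNReal.rpow_ne_top_of_nonneg (one_div_pos.2 hp).le haN
  have hPa : ∀ n, ∫⁻ pr, ENNReal.ofReal ((φ n).normed volume (pr.2 - pr.1)) *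
      ∫⁻ x, ‖⟪a pr.2 x, b pr.1 x⟫‖ₑ ∂μK ∂(μI.prod μI) ≤ Cb * (∫⁻ s, eLpNorm (a s) q μK ^ p ∂μI) ^ (1 / p) := by
    intro n
    have h := hPl n a 0 ha hzero
    rw [hN0, add_zero] at h
    simpa only [Pi.zero_apply, add_zero] using h
  have hDa : ∫⁻ z, ‖⟪a z.1 z.2, b z.1 z.2⟫‖ₑ ∂(μI.prod μK) ≤ Cb * (∫⁻ s, eLpNorm (a s) q μK ^ p ∂μI) ^ (1 / p) := by
    have h := hDl a 0 ha hzero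
    rw [hN0, add_zero] at h
    simpa only [Pi.zero_apply, add_zero] using h
  have hρJ : ∀ n (h : ℝ → X → V) (pr : ℝ × ℝ),
      ‖(φ n).normed volume (pr.2 - pr.1) * ∫ x, ⟪h pr.2 x, b pr.1 x⟫ ∂μK‖ₑ ≤
        ENNReal.ofReal ((φ n).normed volume (pr.2 - pr.1)) * ∫⁻ x, ‖⟪h pr.2 x, b pr.1 x⟫‖ₑ ∂μK := by
    intro n h pr
    rw [enorm_mul, Real.enorm_eq_ofReal ((φ n).nonneg_normed _)]
    exact mul_le_mul' le_rfl (enorm_integral_le_lintegral_enorm _)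
  -- finiteness of slice norms
  have hfa : ∀ᵐ s ∂μI, eLpNorm (a s) q μK < ∞ := by
    filter_upwards [ae_lt_top' ((hHm ha).pow_const p) haN] with s hs
    exact (ENNReal.rpow_lt_top_iff_of_pos hp).1 hs
  have hfb : ∀ᵐ σ ∂μI, eLpNorm (b σ) q' μK < ∞ := by
    filter_upwards [ae_lt_top' (hBm.pow_const p') hbN] with σ hσ
    exact (ENNReal.rpow_lt_top_iff_of_pos hpp'.symm.pos).1 hσ
  refine tendsto_doubledPairing_of_bounds (μ := μ) hφ hδ hK ha haS hb hbi hp hq0 hq' haN hCb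
    ?_ ?_ ?_ ?_ ?_
  · intro n h₁ h₂ hh₁ hh₂
    exact (enorm_integral_le_lintegral_enorm _).trans
      ((lintegral_mono fun pr => hρJ n (fun s x => h₁ s x + h₂ s x) pr).trans (hPl n h₁ h₂ hh₁ hh₂))
  · intro h₁ h₂ hh₁ hh₂
    exact (enorm_integral_le_lintegral_enorm _).trans (hDl h₁ h₂ hh₁ hh₂)
  · intro n
    refine ⟨((φ n).continuous_normed.comp (continuous_snd.sub continuous_fst)).aestronglyMeasurable.mul
      (aestronglyMeasurable_doubled_inner ha hb).integral_prod_right', ?_⟩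
    rw [hasFiniteIntegral_iff_enorm]
    exact ((lintegral_mono fun pr => hρJ n a pr).trans (hPa n)).trans_lt
      (ENNReal.mul_lt_top hCb.lt_top hNa.lt_top)
  · filter_upwards [ae_lintegral_enorm_inner_le (μ := μ) ha hb q q',
      (Measure.quasiMeasurePreserving_snd (μ := μI) (ν := μI)).ae hfa,
      (Measure.quasiMeasurePreserving_fst (μ := μI) (ν := μI)).ae hfb,
      (Measure.quasiMeasurePreserving_snd (μ := μI) (ν := μI)).ae ha.prodMk_left,
      (Measure.quasiMeasurePreserving_fst (μ := μI) (ν := μI)).ae hb.prodMk_left] with pr hH hfa' hfb' hma hmb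
    refine ⟨hma.inner hmb, ?_⟩
    rw [hasFiniteIntegral_iff_enorm]
    exact hH.trans_lt (ENNReal.mul_lt_top hfa' hfb')
  · refine ⟨ha.inner hb, ?_⟩
    rw [hasFiniteIntegral_iff_enorm]
    exact hDa.trans_lt (ENNReal.mul_lt_top hCb.lt_top hNa.lt_top)

end MixedNorm

/-! ## Integrability of the pairings (interface for the applications) -/

section IntegrabilityAPI

variable {X : Type*} [MeasurableSpace X] {μ : Measure X} [SFinite μ]
variable {V : Type*} [NormedAddCommGroup V] [InnerProductSpace ℝ V]

/-- `x ≤ 1 + x ^ p` in `ℝ≥0∞` for `1 ≤ p`. [folklore] -/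
theorem _root_.ENNReal.le_one_add_rpow {p : ℝ} (hp : 1 ≤ p) (x : ℝ≥0∞) : x ≤ 1 + x ^ p := by
  rcases le_total x 1 with h | h
  · exact h.trans le_self_add
  · calc x = x ^ (1 : ℝ) := (ENNReal.rpow_one x).symm
      _ ≤ x ^ p := ENNReal.rpow_le_rpow_of_exponent_le h hp
      _ ≤ 1 + x ^ p := le_add_self

/-- On a finite measure space, `∫ f ≤ μ(univ) + ∫ f^p` (`1 ≤ p`): `L^p ⊂ L¹`. [folklore] -/
theorem lintegral_le_measure_univ_add_lintegral_rpow {α : Type*} [MeasurableSpace α] {ν : Measure α}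
    {f : α → ℝ≥0∞} (hf : AEMeasurable f ν) {p : ℝ} (hp : 1 ≤ p) :
    ∫⁻ x, f x ∂ν ≤ ν univ + ∫⁻ x, f x ^ p ∂ν := by
  calc ∫⁻ x, f x ∂ν ≤ ∫⁻ x, 1 + f x ^ p ∂ν := lintegral_mono fun x => ENNReal.le_one_add_rpow hp _
    _ = ν univ + ∫⁻ x, f x ^ p ∂ν := by
        rw [lintegral_add_right' _ (hf.pow_const p), lintegral_one]

/-- **A.e. `x`-integrability of the doubled integrand**: if a.e. slice of `a` is in `L^q(K)` and
a.e. slice of `b` in `L^{q'}(K)`, then for a.e. `(σ, s)` the function `x ↦ ⟪a(s,x), b(σ,x)⟫` is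
integrable on `K`. [folklore] -/
theorem ae_integrable_inner_slices {T : ℝ} {K : Set X} {a b : ℝ → X → V}
    (ha : AEStronglyMeasurable (uncurry a) ((volume.restrict (Ioo 0 T)).prod (μ.restrict K)))
    (hb : AEStronglyMeasurable (uncurry b) ((volume.restrict (Ioo 0 T)).prod (μ.restrict K)))
    (q q' : ℝ≥0∞) [hqq' : q.HolderConjugate q']
    (hfa : ∀ᵐ s ∂((volume : Measure ℝ).restrict (Ioo 0 T)), eLpNorm (a s) q (μ.restrict K) < ∞)
    (hfb : ∀ᵐ σ ∂((volume : Measure ℝ).restrict (Ioo 0 T)), eLpNorm (b σ) q' (μ.restrict K) < ∞) :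
    ∀ᵐ pr ∂(((volume : Measure ℝ).restrict (Ioo 0 T)).prod ((volume : Measure ℝ).restrict (Ioo 0 T))),
      Integrable (fun x => ⟪a pr.2 x, b pr.1 x⟫) (μ.restrict K) := by
  set μI : Measure ℝ := volume.restrict (Ioo 0 T) with hμI
  filter_upwards [ae_lintegral_enorm_inner_le (μ := μ) ha hb q q',
    (Measure.quasiMeasurePreserving_snd (μ := μI) (ν := μI)).ae hfa,
    (Measure.quasiMeasurePreserving_fst (μ := μI) (ν := μI)).ae hfb,
    (Measure.quasiMeasurePreserving_snd (μ := μI) (ν := μI)).ae ha.prodMk_left,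
    (Measure.quasiMeasurePreserving_fst (μ := μI) (ν := μI)).ae hb.prodMk_left] with pr hH hfa' hfb' hma hmb
  refine ⟨hma.inner hmb, ?_⟩
  rw [hasFiniteIntegral_iff_enorm]
  exact hH.trans_lt (ENNReal.mul_lt_top hfa' hfb')

/-- **A.e. `x`-integrability of the diagonal integrand.** [folklore] -/
theorem ae_integrable_inner_diag {T : ℝ} {K : Set X} {a b : ℝ → X → V}
    (ha : AEStronglyMeasurable (uncurry a) ((volume.restrict (Ioo 0 T)).prod (μ.restrict K)))
    (hb : AEStronglyMeasurable (uncurry b) ((volume.restrict (Ioo 0 T)).prod (μ.restrict K)))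
    (q q' : ℝ≥0∞) [hqq' : q.HolderConjugate q']
    (hfa : ∀ᵐ s ∂((volume : Measure ℝ).restrict (Ioo 0 T)), eLpNorm (a s) q (μ.restrict K) < ∞)
    (hfb : ∀ᵐ σ ∂((volume : Measure ℝ).restrict (Ioo 0 T)), eLpNorm (b σ) q' (μ.restrict K) < ∞) :
    ∀ᵐ s ∂((volume : Measure ℝ).restrict (Ioo 0 T)), Integrable (fun x => ⟪a s x, b s x⟫) (μ.restrict K) := by
  filter_upwards [ae_lintegral_enorm_inner_le_diag (μ := μ) ha hb q q', hfa, hfb, ha.prodMk_left,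
    hb.prodMk_left] with s hH hfa' hfb' hma hmb
  refine ⟨hma.inner hmb, ?_⟩
  rw [hasFiniteIntegral_iff_enorm]
  exact hH.trans_lt (ENNReal.mul_lt_top hfa' hfb')

/-- **Joint integrability of the (kernel-free) doubled pairing** `(σ,s) ↦ ∫_K ⟪a(s,x), b(σ,x)⟫`
on `(0,T)²`, from `∫ ‖a(s)‖_{L^q(K)} ds < ∞` and `∫ ‖b(σ)‖_{L^{q'}(K)} dσ < ∞` (the bound
factorises). [folklore] -/
theorem integrable_integral_inner_prod {T : ℝ} {K : Set X} {a b : ℝ → X → V}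
    (ha : AEStronglyMeasurable (uncurry a) ((volume.restrict (Ioo 0 T)).prod (μ.restrict K)))
    (hb : AEStronglyMeasurable (uncurry b) ((volume.restrict (Ioo 0 T)).prod (μ.restrict K)))
    (q q' : ℝ≥0∞) [hqq' : q.HolderConjugate q']
    (haN : ∫⁻ s, eLpNorm (a s) q (μ.restrict K) ∂(volume.restrict (Ioo 0 T)) ≠ ∞)
    (hbN : ∫⁻ σ, eLpNorm (b σ) q' (μ.restrict K) ∂(volume.restrict (Ioo 0 T)) ≠ ∞) :
    Integrable (fun pr : ℝ × ℝ => ∫ x, ⟪a pr.2 x, b pr.1 x⟫ ∂(μ.restrict K))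
      (((volume : Measure ℝ).restrict (Ioo 0 T)).prod ((volume : Measure ℝ).restrict (Ioo 0 T))) := by
  set μI : Measure ℝ := volume.restrict (Ioo 0 T) with hμI
  set μK : Measure X := μ.restrict K with hμK
  have hHm : AEMeasurable (fun s => eLpNorm (a s) q μK) μI := aemeasurable_eLpNorm_slice ha q
  have hBm : AEMeasurable (fun σ => eLpNorm (b σ) q' μK) μI := aemeasurable_eLpNorm_slice hb q'
  refine ⟨(aestronglyMeasurable_doubled_inner ha hb).integral_prod_right', ?_⟩
  rw [hasFiniteIntegral_iff_enorm]
  calc ∫⁻ pr, ‖∫ x, ⟪a pr.2 x, b pr.1 x⟫ ∂μK‖ₑ ∂(μI.prod μI)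
      ≤ ∫⁻ pr, eLpNorm (a pr.2) q μK * eLpNorm (b pr.1) q' μK ∂(μI.prod μI) := by
        refine lintegral_mono_ae ?_
        filter_upwards [ae_lintegral_enorm_inner_le (μ := μ) ha hb q q'] with pr hpr
        exact (enorm_integral_le_lintegral_enorm _).trans hpr
    _ = ∫⁻ pr, eLpNorm (b pr.1) q' μK * eLpNorm (a pr.2) q μK ∂(μI.prod μI) :=
        lintegral_congr fun pr => mul_comm _ _
    _ = (∫⁻ σ, eLpNorm (b σ) q' μK ∂μI) * ∫⁻ s, eLpNorm (a s) q μK ∂μI := lintegral_prod_mul hBm hHm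
    _ < ∞ := ENNReal.mul_lt_top hbN.lt_top haN.lt_top

/-- **Integrability of the doubled pairing integrand** `(σ,s) ↦ ρ(s-σ) ∫_K ⟪a(s,x), b(σ,x)⟫`.
[folklore] -/
theorem integrable_doubledPairing (φ : ContDiffBump (0 : ℝ)) {T : ℝ} {K : Set X} {a b : ℝ → X → V}
    (ha : AEStronglyMeasurable (uncurry a) ((volume.restrict (Ioo 0 T)).prod (μ.restrict K)))
    (hb : AEStronglyMeasurable (uncurry b) ((volume.restrict (Ioo 0 T)).prod (μ.restrict K)))
    (q q' : ℝ≥0∞) [hqq' : q.HolderConjugate q']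
    (haN : ∫⁻ s, eLpNorm (a s) q (μ.restrict K) ∂(volume.restrict (Ioo 0 T)) ≠ ∞)
    (hbN : ∫⁻ σ, eLpNorm (b σ) q' (μ.restrict K) ∂(volume.restrict (Ioo 0 T)) ≠ ∞) :
    Integrable (fun pr : ℝ × ℝ => φ.normed volume (pr.2 - pr.1) * ∫ x, ⟪a pr.2 x, b pr.1 x⟫ ∂(μ.restrict K))
      (((volume : Measure ℝ).restrict (Ioo 0 T)).prod ((volume : Measure ℝ).restrict (Ioo 0 T))) := by
  obtain ⟨C, hC0, hC⟩ := exists_normed_le φ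
  refine (integrable_integral_inner_prod ha hb q q' haN hbN).bdd_mul (c := C)
    ((φ.continuous_normed.comp (continuous_snd.sub continuous_fst)).aestronglyMeasurable)
    (Eventually.of_forall fun pr => ?_)
  rw [Real.norm_eq_abs, abs_of_nonneg (φ.nonneg_normed _)]
  exact hC _

/-- **Integrability of the diagonal pairing**, `L¹_t L^q_x` against `L^∞_t L^{q'}_x`. [folklore] -/
theorem integrable_inner_diag_of_ae_le {T : ℝ} {K : Set X} {a b : ℝ → X → V}
    (ha : AEStronglyMeasurable (uncurry a) ((volume.restrict (Ioo 0 T)).prod (μ.restrict K)))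
    (hb : AEStronglyMeasurable (uncurry b) ((volume.restrict (Ioo 0 T)).prod (μ.restrict K)))
    (q q' : ℝ≥0∞) [hqq' : q.HolderConjugate q']
    (haN : ∫⁻ s, eLpNorm (a s) q (μ.restrict K) ∂(volume.restrict (Ioo 0 T)) ≠ ∞)
    {Cb : ℝ≥0∞} (hCb : Cb ≠ ∞)
    (hbB : ∀ᵐ σ ∂((volume : Measure ℝ).restrict (Ioo 0 T)), eLpNorm (b σ) q' (μ.restrict K) ≤ Cb) :
    Integrable (fun z : ℝ × X => ⟪a z.1 z.2, b z.1 z.2⟫)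
      (((volume : Measure ℝ).restrict (Ioo 0 T)).prod (μ.restrict K)) := by
  set μI : Measure ℝ := volume.restrict (Ioo 0 T) with hμI
  set μK : Measure X := μ.restrict K with hμK
  have hHm : AEMeasurable (fun s => eLpNorm (a s) q μK) μI := aemeasurable_eLpNorm_slice ha q
  refine ⟨ha.inner hb, ?_⟩
  rw [hasFiniteIntegral_iff_enorm]
  have hzero : AEStronglyMeasurable (uncurry (0 : ℝ → X → V)) (μI.prod μK) := aestronglyMeasurable_const
  have h := lintegral_diag_le (μ := μ) ha hzero hb q q'
  simp only [Pi.zero_apply, add_zero, eLpNorm_zero] at h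
  refine h.trans_lt ?_
  calc ∫⁻ s, eLpNorm (a s) q μK * eLpNorm (b s) q' μK ∂μI ≤ ∫⁻ s, eLpNorm (a s) q μK * Cb ∂μI :=
        lintegral_mono_ae (hbB.mono fun s hs => mul_le_mul' le_rfl hs)
    _ = (∫⁻ s, eLpNorm (a s) q μK ∂μI) * Cb := lintegral_mul_const'' _ hHm
    _ < ∞ := ENNReal.mul_lt_top haN.lt_top hCb.lt_top

/-- **Integrability of the diagonal pairing**, `L^p_t L^q_x` against `L^{p'}_t L^{q'}_x`.
[folklore] -/
theorem integrable_inner_diag_of_rpow {T : ℝ} {K : Set X} {a b : ℝ → X → V}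
    (ha : AEStronglyMeasurable (uncurry a) ((volume.restrict (Ioo 0 T)).prod (μ.restrict K)))
    (hb : AEStronglyMeasurable (uncurry b) ((volume.restrict (Ioo 0 T)).prod (μ.restrict K)))
    {p p' : ℝ} (hpp' : p.HolderConjugate p') (q q' : ℝ≥0∞) [hqq' : q.HolderConjugate q']
    (haN : ∫⁻ s, eLpNorm (a s) q (μ.restrict K) ^ p ∂(volume.restrict (Ioo 0 T)) ≠ ∞)
    (hbN : ∫⁻ σ, eLpNorm (b σ) q' (μ.restrict K) ^ p' ∂(volume.restrict (Ioo 0 T)) ≠ ∞) :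
    Integrable (fun z : ℝ × X => ⟪a z.1 z.2, b z.1 z.2⟫)
      (((volume : Measure ℝ).restrict (Ioo 0 T)).prod (μ.restrict K)) := by
  set μI : Measure ℝ := volume.restrict (Ioo 0 T) with hμI
  set μK : Measure X := μ.restrict K with hμK
  have hHm : AEMeasurable (fun s => eLpNorm (a s) q μK) μI := aemeasurable_eLpNorm_slice ha q
  have hBm : AEMeasurable (fun σ => eLpNorm (b σ) q' μK) μI := aemeasurable_eLpNorm_slice hb q'
  refine ⟨ha.inner hb, ?_⟩
  rw [hasFiniteIntegral_iff_enorm]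
  have hzero : AEStronglyMeasurable (uncurry (0 : ℝ → X → V)) (μI.prod μK) := aestronglyMeasurable_const
  have h := lintegral_diag_le (μ := μ) ha hzero hb q q'
  simp only [Pi.zero_apply, add_zero, eLpNorm_zero] at h
  refine h.trans_lt ?_
  have h2 := ENNReal.lintegral_mul_le_Lp_mul_Lq μI hpp' hHm hBm
  refine (le_of_eq_of_le (by rfl) h2).trans_lt ?_
  exact ENNReal.mul_lt_top (ENNReal.rpow_lt_top_of_nonneg hpp'.one_div_nonneg haN)
    (ENNReal.rpow_lt_top_of_nonneg hpp'.symm.one_div_nonneg hbN)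

omit [InnerProductSpace ℝ V] in
/-- From `∫ ‖a(s)‖_q^p ds < ∞` (`1 ≤ p`) on the finite interval: `∫ ‖a(s)‖_q ds < ∞`. [folklore] -/
theorem lintegral_eLpNorm_slice_ne_top_of_rpow {T : ℝ} {K : Set X} {a : ℝ → X → V}
    (ha : AEStronglyMeasurable (uncurry a) ((volume.restrict (Ioo 0 T)).prod (μ.restrict K)))
    (q : ℝ≥0∞) {p : ℝ} (hp : 1 ≤ p)
    (haN : ∫⁻ s, eLpNorm (a s) q (μ.restrict K) ^ p ∂(volume.restrict (Ioo 0 T)) ≠ ∞) :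
    ∫⁻ s, eLpNorm (a s) q (μ.restrict K) ∂(volume.restrict (Ioo 0 T)) ≠ ∞ := by
  haveI : IsFiniteMeasure ((volume : Measure ℝ).restrict (Ioo 0 T)) := inferInstance
  refine ne_top_of_le_ne_top ?_ (lintegral_le_measure_univ_add_lintegral_rpow (aemeasurable_eLpNorm_slice ha q) hp)
  exact ENNReal.add_ne_top.2 ⟨measure_ne_top _ _, haN⟩

omit [InnerProductSpace ℝ V] in
/-- From `∫ ‖a(s)‖_q^p ds < ∞` (`0 < p`): a.e. slice is in `L^q`. [folklore] -/
theorem ae_eLpNorm_slice_lt_top_of_rpow {T : ℝ} {K : Set X} {a : ℝ → X → V}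
    (ha : AEStronglyMeasurable (uncurry a) ((volume.restrict (Ioo 0 T)).prod (μ.restrict K)))
    (q : ℝ≥0∞) {p : ℝ} (hp : 0 < p)
    (haN : ∫⁻ s, eLpNorm (a s) q (μ.restrict K) ^ p ∂(volume.restrict (Ioo 0 T)) ≠ ∞) :
    ∀ᵐ s ∂((volume : Measure ℝ).restrict (Ioo 0 T)), eLpNorm (a s) q (μ.restrict K) < ∞ := by
  filter_upwards [ae_lt_top' ((aemeasurable_eLpNorm_slice ha q).pow_const p) haN] with s hs
  exact (ENNReal.rpow_lt_top_iff_of_pos hp).1 hs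

end IntegrabilityAPI

/-! ## Packaged form for the applications -/

section Package

variable {X : Type*} [NormedAddCommGroup X] [NormedSpace ℝ X] [FiniteDimensional ℝ X]
  [MeasurableSpace X] [BorelSpace X] {μ : Measure X} [SFinite μ] [IsFiniteMeasureOnCompacts μ]
variable {V : Type*} [NormedAddCommGroup V] [InnerProductSpace ℝ V]

/-- **The doubled-pairing package, `L¹_t L^q_x` against `L^∞_t L^{q'}_x`**: the limit theorem
`tendsto_doubledPairing_of_ae_le` together with the integrability facts used to split and
recombine sums of such pairings (doubled integrand, diagonal integrand, a.e. slices). [folklore] -/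
theorem doubledPairing_package_of_ae_le
    {φ : ℕ → ContDiffBump (0 : ℝ)} (hφ : Tendsto (fun n => (φ n).rOut) atTop (𝓝 0))
    {T δ : ℝ} (hδ : 0 < δ) {K : Set X} (hK : IsCompact K)
    {a b : ℝ → X → V}
    (ha : AEStronglyMeasurable (uncurry a) ((volume.restrict (Ioo 0 T)).prod (μ.restrict K)))
    (haS : ∀ s, s ∉ Icc δ (T - δ) → a s = 0)
    (hb : AEStronglyMeasurable (uncurry b) ((volume.restrict (Ioo 0 T)).prod (μ.restrict K)))
    (hbi : Integrable (uncurry b) ((volume.restrict (Ioo 0 T)).prod (μ.restrict K)))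
    (q q' : ℝ≥0∞) [hqq' : q.HolderConjugate q'] (hq' : q ≠ ∞)
    (haN : ∫⁻ s, eLpNorm (a s) q (μ.restrict K) ∂(volume.restrict (Ioo 0 T)) ≠ ∞)
    {Cb : ℝ≥0∞} (hCb : Cb ≠ ∞)
    (hbB : ∀ᵐ σ ∂((volume : Measure ℝ).restrict (Ioo 0 T)), eLpNorm (b σ) q' (μ.restrict K) ≤ Cb) :
    Tendsto (fun n => ∫ pr, (φ n).normed volume (pr.2 - pr.1) * ∫ x, ⟪a pr.2 x, b pr.1 x⟫ ∂(μ.restrict K)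
        ∂((volume.restrict (Ioo 0 T)).prod (volume.restrict (Ioo 0 T)))) atTop
      (𝓝 (∫ z, ⟪a z.1 z.2, b z.1 z.2⟫ ∂((volume.restrict (Ioo 0 T)).prod (μ.restrict K)))) ∧
    (∀ n, Integrable (fun pr : ℝ × ℝ =>
        (φ n).normed volume (pr.2 - pr.1) * ∫ x, ⟪a pr.2 x, b pr.1 x⟫ ∂(μ.restrict K))
      (((volume : Measure ℝ).restrict (Ioo 0 T)).prod ((volume : Measure ℝ).restrict (Ioo 0 T)))) ∧
    Integrable (fun z : ℝ × X => ⟪a z.1 z.2, b z.1 z.2⟫)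
      (((volume : Measure ℝ).restrict (Ioo 0 T)).prod (μ.restrict K)) ∧
    (∀ᵐ pr ∂(((volume : Measure ℝ).restrict (Ioo 0 T)).prod ((volume : Measure ℝ).restrict (Ioo 0 T))),
      Integrable (fun x => ⟪a pr.2 x, b pr.1 x⟫) (μ.restrict K)) ∧
    (∀ᵐ s ∂((volume : Measure ℝ).restrict (Ioo 0 T)), Integrable (fun x => ⟪a s x, b s x⟫) (μ.restrict K)) := by
  haveI : IsFiniteMeasure ((volume : Measure ℝ).restrict (Ioo 0 T)) := inferInstance
  have hfa : ∀ᵐ s ∂((volume : Measure ℝ).restrict (Ioo 0 T)), eLpNorm (a s) q (μ.restrict K) < ∞ :=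
    ae_lt_top' (aemeasurable_eLpNorm_slice ha q) haN
  have hfb : ∀ᵐ σ ∂((volume : Measure ℝ).restrict (Ioo 0 T)), eLpNorm (b σ) q' (μ.restrict K) < ∞ :=
    hbB.mono fun σ h => h.trans_lt hCb.lt_top
  have hbN : ∫⁻ σ, eLpNorm (b σ) q' (μ.restrict K) ∂(volume.restrict (Ioo 0 T)) ≠ ∞ := by
    refine ne_top_of_le_ne_top ?_ (lintegral_mono_ae hbB)
    rw [lintegral_const]
    exact ENNReal.mul_ne_top hCb (measure_ne_top _ _)
  exact ⟨tendsto_doubledPairing_of_ae_le hφ hδ hK ha haS hb hbi hq' haN hCb hbB,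
    fun n => integrable_doubledPairing (φ n) ha hb q q' haN hbN,
    integrable_inner_diag_of_ae_le ha hb q q' haN hCb hbB,
    ae_integrable_inner_slices ha hb q q' hfa hfb,
    ae_integrable_inner_diag ha hb q q' hfa hfb⟩

/-- **The doubled-pairing package, `L^p_t L^q_x` against `L^{p'}_t L^{q'}_x`** (`1 < p < ∞`).
[folklore] -/
theorem doubledPairing_package_of_rpow
    {φ : ℕ → ContDiffBump (0 : ℝ)} (hφ : Tendsto (fun n => (φ n).rOut) atTop (𝓝 0))
    {T δ : ℝ} (hδ : 0 < δ) {K : Set X} (hK : IsCompact K)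
    {a b : ℝ → X → V}
    (ha : AEStronglyMeasurable (uncurry a) ((volume.restrict (Ioo 0 T)).prod (μ.restrict K)))
    (haS : ∀ s, s ∉ Icc δ (T - δ) → a s = 0)
    (hb : AEStronglyMeasurable (uncurry b) ((volume.restrict (Ioo 0 T)).prod (μ.restrict K)))
    (hbi : Integrable (uncurry b) ((volume.restrict (Ioo 0 T)).prod (μ.restrict K)))
    {p p' : ℝ} (hpp' : p.HolderConjugate p') (q q' : ℝ≥0∞) [hqq' : q.HolderConjugate q'] (hq' : q ≠ ∞)
    (haN : ∫⁻ s, eLpNorm (a s) q (μ.restrict K) ^ p ∂(volume.restrict (Ioo 0 T)) ≠ ∞)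
    (hbN : ∫⁻ σ, eLpNorm (b σ) q' (μ.restrict K) ^ p' ∂(volume.restrict (Ioo 0 T)) ≠ ∞) :
    Tendsto (fun n => ∫ pr, (φ n).normed volume (pr.2 - pr.1) * ∫ x, ⟪a pr.2 x, b pr.1 x⟫ ∂(μ.restrict K)
        ∂((volume.restrict (Ioo 0 T)).prod (volume.restrict (Ioo 0 T)))) atTop
      (𝓝 (∫ z, ⟪a z.1 z.2, b z.1 z.2⟫ ∂((volume.restrict (Ioo 0 T)).prod (μ.restrict K)))) ∧
    (∀ n, Integrable (fun pr : ℝ × ℝ =>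
        (φ n).normed volume (pr.2 - pr.1) * ∫ x, ⟪a pr.2 x, b pr.1 x⟫ ∂(μ.restrict K))
      (((volume : Measure ℝ).restrict (Ioo 0 T)).prod ((volume : Measure ℝ).restrict (Ioo 0 T)))) ∧
    Integrable (fun z : ℝ × X => ⟪a z.1 z.2, b z.1 z.2⟫)
      (((volume : Measure ℝ).restrict (Ioo 0 T)).prod (μ.restrict K)) ∧
    (∀ᵐ pr ∂(((volume : Measure ℝ).restrict (Ioo 0 T)).prod ((volume : Measure ℝ).restrict (Ioo 0 T))),
      Integrable (fun x => ⟪a pr.2 x, b pr.1 x⟫) (μ.restrict K)) ∧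
    (∀ᵐ s ∂((volume : Measure ℝ).restrict (Ioo 0 T)), Integrable (fun x => ⟪a s x, b s x⟫) (μ.restrict K)) := by
  have hfa := ae_eLpNorm_slice_lt_top_of_rpow ha q hpp'.pos haN
  have hfb := ae_eLpNorm_slice_lt_top_of_rpow hb q' hpp'.symm.pos hbN
  have haN1 := lintegral_eLpNorm_slice_ne_top_of_rpow ha q hpp'.lt.le haN
  have hbN1 := lintegral_eLpNorm_slice_ne_top_of_rpow hb q' hpp'.symm.lt.le hbN
  exact ⟨tendsto_doubledPairing_of_rpow hφ hδ hK ha haS hb hbi hpp' hq' haN hbN,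
    fun n => integrable_doubledPairing (φ n) ha hb q q' haN1 hbN1,
    integrable_inner_diag_of_rpow ha hb hpp' q q' haN hbN,
    ae_integrable_inner_slices ha hb q q' hfa hfb,
    ae_integrable_inner_diag ha hb q q' hfa hfb⟩

end Package

end Literature.Analysis.FunctionSpaces
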